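import Literature.Analysis.Potential.ArcsineLogPotential
import Literature.Analysis.Potential.LogEnergyLayers
import Literature.Analysis.Potential.LogEnergyKernels
import Mathlib.Analysis.SpecialFunctions.Integrals.Basic
import Mathlib.MeasureTheory.Integral.Prod
import Mathlib.MeasureTheory.Group.Integral
import Mathlib.MeasureTheory.Measure.Haar.Unique
import HarnessLib

/-!
# The hook form against the arcsine law: energy of the limit shape and the linear term

Topic `Analysis/Potential`, namespace `Literature.Analysis.Potential`. The **hook form** of two
densities `φ, χ` on `ℝ` is `𝔅(φ, χ) := ∬_{x<y} log (y - x) φ(x) χ(y) dx dy`, written here as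
`∫ p, upperLogKernel p * φ p.1 * χ p.2` with the kernel `T(x,y) = 1{x<y} log (y-x)`
(`upperLogKernel`); the Vershik–Kerov hook integral of a diagram with rotated boundary `ω` is
`𝔅((1+ω')/2, (1-ω')/2)` (Vershik–Kerov 1985, Lemma 1). Let `F_a(x) = ½ + arcsin(x/a)/π`
(`arcsineCDF`) be the distribution function of the arcsine law of `[-a, a]` — for `a = 2√N` this is
`(1 + Ω_N')/2` for the Logan–Shepp–Vershik–Kerov limit shape `Ω_N`. PROVED here (all classical
analysis; the organisation — the arcsine law as the law of `a cos B`, `B` uniform on `[0, π]`,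
reflection symmetry, and the potential/first-moment identities — is ours):

* `integral_ite_mul_cos_le` — `F_a` IS the law of `a cos B`: `∫_0^π 1{a cos β ≤ x} dβ = π F_a(x)`;
* `integral_upperLogKernel_mul_avgIndicator` — Fubini lemma
  `𝔅(φ, ∫_0^π 1{· < a cos β} dβ) = ∫_0^π ∫ φ(x) Λ((a cos β - x)₊) dx dβ`, `Λ(u) = u log u - u`
  (`logPrim`), for bounded measurable compactly supported `φ`;
* `hookForm_refl` — reflection symmetry `𝔅(f, g) = 𝔅(g ∘ neg, f ∘ neg)`;
* **`hookForm_arcsine`** — `𝔅(F_a, 1 - F_a) = (a²/4)(log (a/2) - ½)`; at `a = 2√N` this is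
  Vershik–Kerov's / Logan–Shepp's value `½ (N log N - N)` of the hook integral of `Ω_N`
  (Vershik–Kerov 1985, Lemma 2). Proof: `= π⁻² ∬ Λ₂((a cos β - a cos α)₊)`, `Λ₂ = ∫Λ`, then
  `∬ w² log|w| = 2 ∫ a cos β ∫ w log|w|` by antisymmetry and the two arcsine identities
  `∫_0^π log|x - a cos α| dα = π log (a/2)` (tree, `ArcsineLogPotential`) and
  `∫_0^π cos α log|x - a cos α| dα = -π x/a` (`integral_cos_mul_log_abs_sub_mul_cos`, from the
  first Fourier coefficient of the circle kernel, `CircleLogKernel`), `|x| ≤ a`;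
* **`hookForm_linear_eq`** — the linear term: `𝔅(η, 1 - F_a) - 𝔅(F_a, η) = ∫ η Ψ_a` with
  `Ψ_a(x) = π⁻¹ ∫_0^π Λ(a cos β - x) dβ` (`arcsineLinPot`);
* `integral_arcsinePot` — `∫_{s₀}^{s₁} U_a = -(Ψ_a(s₁) - Ψ_a(s₀))`, `U_a` the logarithmic potential
  of the arcsine law (`arcsinePot`, `= log (a/2)` on `[-a, a]`, `≥` outside);
* **`integral_mul_arcsineLinPot_nonneg`** — for a neutral (`∫η = 0`), area-balanced (`∫ x η = 0`)
  bounded compactly supported `η` that is `≥ 0` left of `-a` and `≤ 0` right of `a`: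
  `0 ≤ ∫ η Ψ_a` — Vershik–Kerov's `θ̄_N ≥ 0` (Vershik–Kerov 1985, Lemma 4: `Ω` is a critical point
  of the hook integral among diagrams of the same area, and diagrams lie above `|x|`).

With `LogEnergyLayers.lean` (the quadratic term) this is the whole analytic side of the
Vershik–Kerov upper bound `max_{λ ⊢ N} dim λ ≤ √(N!) e^{-c₂√N(1+o(1))}`
(`Literature/RepresentationTheory/FiniteGroups/VershikKerov*`).

## References

* A. M. Vershik, S. V. Kerov, Funct. Anal. Appl. 19 (1985) 21–31, Lemmas 1–4. [VershikKerov1985]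
* B. F. Logan, L. A. Shepp, *A variational problem for random Young tableaux*, Adv. Math. 26 (1977)
  206–222 (the value of the functional at the limit shape).
* S. Mkrtchyan, Europ. J. Combin. 33 (2012), arXiv:1008.3854, Prop. 3.1, 4.1. [Mkrtchyan2012]

## Mathlib and tree

Mathlib: `integral_log`, `Real.arcsin` (clamped), `Real.strictAntiOn_cos`, `Real.continuous_mul_log`,
`MeasureTheory.integral_integral_swap`, `MeasureTheory.integrable_prod_iff`,
`MeasurePreserving.integral_comp'`, `MeasurableEquiv.prodComm/prodCongr/neg`,
`intervalIntegral.continuous_parametric_intervalIntegral_of_continuous'`. Tree: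
`integral_log_abs_sub_mul_cos_of_abs_le`, `twoPi_mul_log_half_le_integral_log_abs_sub_mul_cos`,
`intervalIntegrable_log_abs_sub_mul_cos`, `ae_log_abs_cos_sub_cos_eq`, `exists_eq_mul_cos`
(`ArcsineLogPotential.lean`); `integral_circleLogKernel_sub_mul`, `intervalIntegrable_circleLogKernel_sub'`
(`CircleLogKernel.lean`); `integrable_mul_mul_kernel`, `integrable_of_bounded_of_eq_zero_off`,
`integrableOn_Icc_of_intervalIntegrable`, `integrable_of_bounded_Icc` (`LogEnergyLayers.lean`);
`integral_abs_log_abs_sub_le` (`LogEnergyKernels.lean`).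
-/

noncomputable section

open _root_.MeasureTheory _root_.Set _root_.Filter intervalIntegral
open scoped Real Topology Interval

namespace Literature.Analysis.Potential


/-! ### Halving `[-π, π]`-integrals of functions of `cos` -/

/-- `∫_{-π}^{π} g(cos β) dβ = 2 ∫_0^π g(cos β) dβ` (evenness of `cos`). [folklore] -/
theorem integral_comp_cos_neg_pi_pi {g : ℝ → ℝ}
    (hg : IntervalIntegrable (fun β => g (Real.cos β)) volume (-π) π) :
    ∫ β in (-π)..π, g (Real.cos β) = 2 * ∫ β in (0:ℝ)..π, g (Real.cos β) := by
  have hπ := Real.pi_pos.le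
  have hsub1 : uIcc (-π) 0 ⊆ uIcc (-π) π := by
    rw [uIcc_of_le (by linarith), uIcc_of_le (by linarith)]; exact Icc_subset_Icc le_rfl hπ
  have hsub2 : uIcc 0 π ⊆ uIcc (-π) π := by
    rw [uIcc_of_le hπ, uIcc_of_le (by linarith)]; exact Icc_subset_Icc (by linarith) le_rfl
  rw [← integral_add_adjacent_intervals (hg.mono_set hsub1) (hg.mono_set hsub2)]
  have hneg : ∫ β in (-π)..0, g (Real.cos β) = ∫ β in (0:ℝ)..π, g (Real.cos β) := by
    have h := intervalIntegral.integral_comp_neg (a := (0:ℝ)) (b := π) (fun β => g (Real.cos β))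
    simp only [Real.cos_neg, neg_zero] at h
    rw [← h]
  rw [hneg]
  ring

/-- **The arcsine potential on the segment, `[0, π]` form**: for `0 < a` and `|x| ≤ a`,
`∫_0^π log |x - a cos β| dβ = π log (a/2)`. [folklore] -/
theorem integral_log_abs_sub_mul_cos_zero_pi {x a : ℝ} (ha : 0 < a) (hx : |x| ≤ a) :
    ∫ β in (0:ℝ)..π, Real.log |x - a * Real.cos β| = π * Real.log (a / 2) := by
  have h := integral_comp_cos_neg_pi_pi (g := fun y => Real.log |x - a * y|)
    (intervalIntegrable_log_abs_sub_mul_cos ha x)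
  rw [integral_log_abs_sub_mul_cos_of_abs_le ha hx] at h
  linarith

/-- For `0 < a` and every real `x`: `π log (a/2) ≤ ∫_0^π log |x - a cos β| dβ`. [folklore] -/
theorem pi_mul_log_half_le_integral_log_abs_sub_mul_cos_zero_pi {a : ℝ} (ha : 0 < a) (x : ℝ) :
    π * Real.log (a / 2) ≤ ∫ β in (0:ℝ)..π, Real.log |x - a * Real.cos β| := by
  have h := integral_comp_cos_neg_pi_pi (g := fun y => Real.log |x - a * y|)
    (intervalIntegrable_log_abs_sub_mul_cos ha x)
  have h2 := twoPi_mul_log_half_le_integral_log_abs_sub_mul_cos ha x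
  linarith

/-- Integrability of `β ↦ log |x - a cos β|` on `[0, π]`. [folklore] -/
theorem intervalIntegrable_log_abs_sub_mul_cos_zero_pi {a : ℝ} (ha : 0 < a) (x : ℝ) :
    IntervalIntegrable (fun β => Real.log |x - a * Real.cos β|) volume 0 π :=
  (intervalIntegrable_log_abs_sub_mul_cos ha x).mono_set (by
    rw [uIcc_of_le Real.pi_pos.le, uIcc_of_le (by linarith [Real.pi_pos])]
    exact Icc_subset_Icc (by linarith [Real.pi_pos]) le_rfl)

/-! ### The first moment of the arcsine potential: `∫_0^π cos β log |x - a cos β| dβ = -π x/a` -/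

/-- `∫_{-π}^{π} cos β · log |cos φ - cos β| dβ = -2π cos φ` (the first Fourier coefficient of the
circle kernel, `∫ ℓ cos = -π`, twice). [folklore] -/
theorem integral_cos_mul_log_abs_cos_sub_cos (φ : ℝ) :
    ∫ β in (-π)..π, Real.cos β * Real.log |Real.cos φ - Real.cos β| = -2 * π * Real.cos φ := by
  have hae : ∀ᵐ β : ℝ, β ∈ Ι (-π) π → Real.cos β * Real.log |Real.cos φ - Real.cos β| =
      circleLogKernel (φ - β) * (0 + 1 * Real.cos β) +
        circleLogKernel (-φ - β) * (0 + 1 * Real.cos β) - Real.log 2 * Real.cos β := by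
    filter_upwards [ae_log_abs_cos_sub_cos_eq φ] with β hβ _
    rw [hβ, show -φ - β = -(φ + β) by ring, circleLogKernel_neg]
    ring
  have hi1 : IntervalIntegrable (fun β => circleLogKernel (φ - β) * (0 + 1 * Real.cos β))
      volume (-π) π :=
    (intervalIntegrable_circleLogKernel_sub' φ _ _).mul_continuousOn (by fun_prop)
  have hi2 : IntervalIntegrable (fun β => circleLogKernel (-φ - β) * (0 + 1 * Real.cos β))
      volume (-π) π :=
    (intervalIntegrable_circleLogKernel_sub' (-φ) _ _).mul_continuousOn (by fun_prop)
  have hi3 : IntervalIntegrable (fun β => Real.log 2 * Real.cos β) volume (-π) π :=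
    (continuous_const.mul Real.continuous_cos).intervalIntegrable _ _
  rw [intervalIntegral.integral_congr_ae hae, intervalIntegral.integral_sub (hi1.add hi2) hi3,
    intervalIntegral.integral_add hi1 hi2, integral_circleLogKernel_sub_mul,
    integral_circleLogKernel_sub_mul, intervalIntegral.integral_const_mul, integral_cos,
    Real.cos_neg, Real.sin_neg, Real.sin_pi]
  ring

/-- **First moment of the arcsine potential**: for `0 < a` and `|x| ≤ a`,
`∫_0^π cos β · log |x - a cos β| dβ = -π x / a` (with `x = a cos φ`:
`log |x - a cos β| = log a + log |cos φ - cos β|`, `∫_0^π cos = 0`, and the previous lemma halved).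
[folklore] -/
theorem integral_cos_mul_log_abs_sub_mul_cos {x a : ℝ} (ha : 0 < a) (hx : |x| ≤ a) :
    ∫ β in (0:ℝ)..π, Real.cos β * Real.log |x - a * Real.cos β| = -π * x / a := by
  obtain ⟨φ, hxa⟩ := exists_eq_mul_cos ha hx
  -- on `[-π, π]`
  have hae : ∀ᵐ β : ℝ, β ∈ Ι (-π) π → Real.cos β * Real.log |x - a * Real.cos β| =
      Real.log a * Real.cos β + Real.cos β * Real.log |Real.cos φ - Real.cos β| := by
    filter_upwards [ae_cos_ne_cos φ] with β hβ _
    rw [hxa, ← mul_sub, abs_mul, abs_of_pos ha,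
      Real.log_mul ha.ne' (abs_ne_zero.mpr (sub_ne_zero.mpr (Ne.symm hβ)))]
    ring
  have hi0 : IntervalIntegrable (fun β => Real.cos β * Real.log |Real.cos φ - Real.cos β|)
      volume (-π) π :=
    (intervalIntegrable_log_abs_cos_sub_cos φ _ _).continuousOn_mul (by fun_prop)
  have hi4 : IntervalIntegrable (fun β => Real.log a * Real.cos β) volume (-π) π :=
    (continuous_const.mul Real.continuous_cos).intervalIntegrable _ _
  have hfull : ∫ β in (-π)..π, Real.cos β * Real.log |x - a * Real.cos β| =
      -2 * π * Real.cos φ := by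
    rw [intervalIntegral.integral_congr_ae hae, intervalIntegral.integral_add hi4 hi0,
      intervalIntegral.integral_const_mul, integral_cos, integral_cos_mul_log_abs_cos_sub_cos,
      Real.sin_neg, Real.sin_pi]
    ring
  -- halve
  have hint : IntervalIntegrable (fun β => Real.cos β * Real.log |x - a * Real.cos β|)
      volume (-π) π :=
    (intervalIntegrable_log_abs_sub_mul_cos ha x).continuousOn_mul (by fun_prop)
  have h := integral_comp_cos_neg_pi_pi (g := fun y => y * Real.log |x - a * y|) hint
  rw [hfull] at h
  have h2 : ∫ β in (0:ℝ)..π, Real.cos β * Real.log |x - a * Real.cos β| = -π * Real.cos φ := by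
    linarith
  rw [h2, hxa]
  field_simp

/-! ### The primitives `Λ(u) = u log u - u` and `Λ₂(w) = ½ w² log w - ¾ w²` of `log` -/

/-- `Λ(u) := u log u - u`, the primitive of `log` vanishing at `0` (odd, continuous; Lean's
`log |u|` convention makes `Λ(-u) = -Λ(u)` exact). [folklore] -/
def logPrim (u : ℝ) : ℝ := u * Real.log u - u

/-- `Λ₂(w) := ½ w² log w - ¾ w²`, the primitive of `Λ` vanishing at `0`; for `w > 0` it is the
double integral `∬_{0<x<y<w} log (y - x) dx dy`. [folklore] -/
def logPrim₂ (w : ℝ) : ℝ := w ^ 2 / 2 * Real.log w - 3 / 4 * w ^ 2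

/-- `Λ(0) = 0`. [folklore] -/
@[simp] theorem logPrim_zero : logPrim 0 = 0 := by simp [logPrim]

/-- `Λ₂(0) = 0`. [folklore] -/
@[simp] theorem logPrim₂_zero : logPrim₂ 0 = 0 := by simp [logPrim₂]

/-- `Λ` is odd. [folklore] -/
theorem logPrim_neg (u : ℝ) : logPrim (-u) = -logPrim u := by
  simp only [logPrim, Real.log_neg_eq_log]; ring

/-- `Λ` is continuous. [folklore] -/
theorem continuous_logPrim : Continuous logPrim :=
  Real.continuous_mul_log.sub continuous_id

/-- `Λ₂` is continuous. [folklore] -/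
theorem continuous_logPrim₂ : Continuous logPrim₂ := by
  have h : Continuous fun w : ℝ => w ^ 2 / 2 * Real.log w := by
    have : (fun w : ℝ => w ^ 2 / 2 * Real.log w) = fun w => w / 2 * (w * Real.log w) := by
      ext w; ring
    rw [this]
    exact (continuous_id.div_const 2).mul Real.continuous_mul_log
  unfold logPrim₂
  exact h.sub (continuous_const.mul (continuous_pow 2))

/-- `∫_a^b log = Λ(b) - Λ(a)` (Mathlib's `integral_log`, all real `a, b`). [folklore] -/
theorem integral_log_eq_logPrim_sub (a b : ℝ) :
    ∫ s in a..b, Real.log s = logPrim b - logPrim a := by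
  rw [integral_log, logPrim, logPrim]; ring

/-- `∫_x^d log (y - x) dy = Λ(d - x)`. [folklore] -/
theorem integral_log_sub_eq_logPrim (x d : ℝ) :
    ∫ y in x..d, Real.log (y - x) = logPrim (d - x) := by
  rw [intervalIntegral.integral_comp_sub_right (fun u => Real.log u) x, sub_self,
    integral_log_eq_logPrim_sub, logPrim_zero, sub_zero]

/-- `∫_{s₀}^{s₁} log |u - c| du = Λ(s₁ - c) - Λ(s₀ - c)`. [folklore] -/
theorem integral_log_abs_sub_eq_logPrim (s₀ s₁ c : ℝ) :
    ∫ u in s₀..s₁, Real.log |u - c| = logPrim (s₁ - c) - logPrim (s₀ - c) := by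
  simp_rw [Real.log_abs]
  rw [intervalIntegral.integral_comp_sub_right (fun u => Real.log u) c,
    integral_log_eq_logPrim_sub]

/-- `∫_0^w Λ = Λ₂(w)` for `w ≥ 0`. [folklore] -/
theorem integral_logPrim (w : ℝ) (hw : 0 ≤ w) : ∫ u in (0:ℝ)..w, logPrim u = logPrim₂ w := by
  have hderiv : ∀ u ∈ Ioo 0 w, HasDerivAt logPrim₂ (logPrim u) u := by
    intro u hu
    have hu0 : u ≠ 0 := hu.1.ne'
    have h1 : HasDerivAt (fun w : ℝ => w ^ 2 / 2 * Real.log w)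
        (2 * u ^ 1 / 2 * Real.log u + u ^ 2 / 2 * u⁻¹) u :=
      (((hasDerivAt_pow 2 u).div_const 2).mul (Real.hasDerivAt_log hu0))
    have h2 : HasDerivAt (fun w : ℝ => 3 / 4 * w ^ 2) (3 / 4 * (2 * u ^ 1)) u :=
      (hasDerivAt_pow 2 u).const_mul _
    have h := h1.sub h2
    refine h.congr_deriv ?_
    rw [logPrim]
    field_simp
    ring
  rw [intervalIntegral.integral_eq_sub_of_hasDerivAt_of_le hw continuous_logPrim₂.continuousOn hderiv
    (continuous_logPrim.intervalIntegrable _ _), logPrim₂_zero, sub_zero]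

/-- `∫_c^d Λ(d - x) dx = Λ₂(d - c)` for `c ≤ d`. [folklore] -/
theorem integral_logPrim_sub (c d : ℝ) (hcd : c ≤ d) :
    ∫ x in c..d, logPrim (d - x) = logPrim₂ (d - c) := by
  rw [intervalIntegral.integral_comp_sub_left logPrim d, sub_self, integral_logPrim _ (by linarith)]

/-! ### The arcsine distribution function -/

/-- **The arcsine distribution function of `[-a, a]`**: `F_a(x) = ½ + arcsin(x/a)/π`
(Mathlib's `arcsin` is clamped, so `F_a = 0` on `(-∞, -a]` and `= 1` on `[a, ∞)`); for `a = 2√N`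
this is `(1 + Ω_N'(x))/2` for the Logan–Shepp–Vershik–Kerov limit shape. It is the law of `a cos B`,
`B` uniform on `[0, π]` (`integral_indicator_mul_cos_le`). [folklore] -/
def arcsineCDF (a x : ℝ) : ℝ := 1 / 2 + Real.arcsin (x / a) / π

/-- `F_a = 0` on `(-∞, -a]`. [folklore] -/
theorem arcsineCDF_of_le_neg {a x : ℝ} (ha : 0 < a) (hx : x ≤ -a) : arcsineCDF a x = 0 := by
  rw [arcsineCDF, Real.arcsin_of_le_neg_one ((div_le_iff₀ ha).mpr (by linarith))]
  field_simp
  ring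

/-- `F_a = 1` on `[a, ∞)`. [folklore] -/
theorem arcsineCDF_of_le {a x : ℝ} (ha : 0 < a) (hx : a ≤ x) : arcsineCDF a x = 1 := by
  rw [arcsineCDF, Real.arcsin_of_one_le ((one_le_div ha).mpr hx)]
  field_simp
  ring

/-- `F_a(-x) = 1 - F_a(x)` (exactly, `arcsin` being odd). [folklore] -/
theorem arcsineCDF_neg (a x : ℝ) : arcsineCDF a (-x) = 1 - arcsineCDF a x := by
  rw [arcsineCDF, arcsineCDF, neg_div, Real.arcsin_neg]; ring

/-- `0 ≤ F_a`. [folklore] -/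
theorem arcsineCDF_nonneg (a x : ℝ) : 0 ≤ arcsineCDF a x := by
  rw [arcsineCDF]
  have h := Real.neg_pi_div_two_le_arcsin (x / a)
  have hπ := Real.pi_pos
  rw [show 1 / 2 + Real.arcsin (x / a) / π = (π / 2 + Real.arcsin (x / a)) / π by
    field_simp]
  exact div_nonneg (by linarith) hπ.le

/-- `F_a ≤ 1`. [folklore] -/
theorem arcsineCDF_le_one (a x : ℝ) : arcsineCDF a x ≤ 1 := by
  have h := arcsineCDF_nonneg a (-x)
  rw [arcsineCDF_neg] at h
  linarith

/-- `F_a` is monotone (`a > 0`). [folklore] -/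
theorem monotone_arcsineCDF {a : ℝ} (ha : 0 < a) : Monotone (arcsineCDF a) := by
  intro x y hxy
  unfold arcsineCDF
  have h := Real.monotone_arcsin (div_le_div_of_nonneg_right hxy ha.le)
  have hπ := Real.pi_pos
  gcongr

/-- `F_a` is continuous. [folklore] -/
theorem continuous_arcsineCDF (a : ℝ) : Continuous (arcsineCDF a) := by
  unfold arcsineCDF; fun_prop

/-- An `Ioo`-congruence for interval integrals. [folklore] -/
theorem intervalIntegral_congr_Ioo {f g : ℝ → ℝ} {a b : ℝ} (hab : a ≤ b)
    (h : EqOn f g (Ioo a b)) : ∫ x in a..b, f x = ∫ x in a..b, g x := by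
  rw [integral_of_le hab, integral_of_le hab, integral_Ioc_eq_integral_Ioo,
    integral_Ioc_eq_integral_Ioo]
  exact setIntegral_congr_fun measurableSet_Ioo h

/-- Measurability of `β ↦ 1{a cos β ≤ x}`. [folklore] -/
theorem measurable_ite_mul_cos_le (a x : ℝ) :
    Measurable fun β : ℝ => if a * Real.cos β ≤ x then (1:ℝ) else 0 :=
  Measurable.ite (measurableSet_le (by fun_prop) measurable_const) measurable_const
    measurable_const

/-- Interval integrability of `β ↦ 1{a cos β ≤ x}`. [folklore] -/
theorem intervalIntegrable_ite_mul_cos_le (a x b c : ℝ) :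
    IntervalIntegrable (fun β : ℝ => if a * Real.cos β ≤ x then (1:ℝ) else 0) volume b c := by
  refine (intervalIntegrable_const (c := (1:ℝ))).mono_fun'
    (measurable_ite_mul_cos_le a x).aestronglyMeasurable (Eventually.of_forall fun β => ?_)
  simp only
  split_ifs <;> simp

/-- **`F_a` is the law of `a cos B`, `B` uniform on `[0, π]`**: for `0 < a`,
`∫_0^π 1{a cos β ≤ x} dβ = π F_a(x)` (the set is `[arccos (x/a), π]`). [folklore] -/
theorem integral_ite_mul_cos_le {a : ℝ} (ha : 0 < a) (x : ℝ) :
    ∫ β in (0:ℝ)..π, (if a * Real.cos β ≤ x then (1:ℝ) else 0) = π * arcsineCDF a x := by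
  have hπ := Real.pi_pos
  rcases le_or_gt a x with hax | hxa
  · -- `x ≥ a`: the indicator is `1`
    rw [arcsineCDF_of_le ha hax, mul_one]
    have h : ∫ β in (0:ℝ)..π, (if a * Real.cos β ≤ x then (1:ℝ) else 0) = ∫ _ in (0:ℝ)..π, (1:ℝ) := by
      refine integral_congr fun β _ => ?_
      have : a * Real.cos β ≤ x :=
        (mul_le_of_le_one_right ha.le (Real.cos_le_one β)).trans hax
      simp [this]
    rw [h, intervalIntegral.integral_const, sub_zero, smul_eq_mul, mul_one]
  rcases lt_or_ge x (-a) with hxa' | hax'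
  · -- `x < -a`: the indicator is `0`
    rw [arcsineCDF_of_le_neg ha hxa'.le, mul_zero]
    have h : ∫ β in (0:ℝ)..π, (if a * Real.cos β ≤ x then (1:ℝ) else 0) = ∫ _ in (0:ℝ)..π, (0:ℝ) := by
      refine integral_congr fun β _ => ?_
      have : ¬ a * Real.cos β ≤ x := by
        intro h
        have := Real.neg_one_le_cos β
        nlinarith
      simp [this]
    rw [h, intervalIntegral.integral_const, smul_zero]
  · -- `-a ≤ x < a`: the set is `[arccos (x/a), π]`
    have h1 : -1 ≤ x / a := by rw [le_div_iff₀ ha]; linarith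
    have h2 : x / a ≤ 1 := by rw [div_le_iff₀ ha]; linarith
    have h2' : x / a < 1 := by rw [div_lt_iff₀ ha]; linarith
    set c : ℝ := Real.arccos (x / a) with hc
    have hc0 : 0 < c := Real.arccos_pos.mpr h2'
    have hcπ : c ≤ π := Real.arccos_le_pi _
    have hcos : Real.cos c = x / a := Real.cos_arccos h1 h2
    have hcmem : c ∈ Icc 0 π := ⟨hc0.le, hcπ⟩
    rw [← integral_add_adjacent_intervals (b := c) (intervalIntegrable_ite_mul_cos_le a x _ _)
      (intervalIntegrable_ite_mul_cos_le a x _ _)]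
    have hI1 : ∫ β in (0:ℝ)..c, (if a * Real.cos β ≤ x then (1:ℝ) else 0) = 0 := by
      rw [intervalIntegral_congr_Ioo hc0.le (g := fun _ => 0), intervalIntegral.integral_zero]
      intro β hβ
      have hβmem : β ∈ Icc 0 π := ⟨hβ.1.le, hβ.2.le.trans hcπ⟩
      have hlt : Real.cos c < Real.cos β := Real.strictAntiOn_cos hβmem hcmem hβ.2
      have : ¬ a * Real.cos β ≤ x := by
        intro h
        rw [hcos, div_lt_iff₀ ha] at hlt
        linarith
      simp [this]
    have hI2 : ∫ β in c..π, (if a * Real.cos β ≤ x then (1:ℝ) else 0) = π - c := by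
      rw [intervalIntegral_congr_Ioo hcπ (g := fun _ => 1), intervalIntegral.integral_const, smul_eq_mul, mul_one]
      intro β hβ
      have hβmem : β ∈ Icc 0 π := ⟨hc0.le.trans hβ.1.le, hβ.2.le⟩
      have hlt : Real.cos β < Real.cos c := Real.strictAntiOn_cos hcmem hβmem hβ.1
      have : a * Real.cos β ≤ x := by
        rw [hcos, lt_div_iff₀ ha] at hlt
        linarith
      simp [this]
    rw [hI1, hI2, hc, Real.arccos_eq_pi_div_two_sub_arcsin, arcsineCDF]
    field_simp
    ring

/-- The complementary law: `∫_0^π 1{x < a cos β} dβ = π (1 - F_a(x))`. [folklore] -/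
theorem integral_ite_lt_mul_cos {a : ℝ} (ha : 0 < a) (x : ℝ) :
    ∫ β in (0:ℝ)..π, (if x < a * Real.cos β then (1:ℝ) else 0) = π * (1 - arcsineCDF a x) := by
  have h : ∀ β : ℝ, (if x < a * Real.cos β then (1:ℝ) else 0) =
      1 - (if a * Real.cos β ≤ x then (1:ℝ) else 0) := by
    intro β
    by_cases hβ : a * Real.cos β ≤ x
    · simp [hβ, not_lt.mpr hβ]
    · simp [hβ, not_le.mp hβ]
  simp_rw [h]
  rw [intervalIntegral.integral_sub intervalIntegrable_const (intervalIntegrable_ite_mul_cos_le a x _ _),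
    intervalIntegral.integral_const, integral_ite_mul_cos_le ha, smul_eq_mul, sub_zero, mul_one]
  ring

/-! ### The upper log kernel `T(x, y) = 1{x < y} log (y - x)` and its Fubini lemma -/

/-- The **hook kernel** `T(x, y) := log (y - x)` for `x < y`, `0` otherwise: the kernel of the
Vershik–Kerov hook integral `¼ ∬_{x<y} log (y-x) (1 + ω'(x)) (1 - ω'(y)) dx dy`.
[cite: VershikKerov1985, Lemma 1] -/
def upperLogKernel (p : ℝ × ℝ) : ℝ := if p.1 < p.2 then Real.log (p.2 - p.1) else 0

/-- The same kernel as a function of `x - y`. [folklore] -/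
def upperLogKernel₁ (t : ℝ) : ℝ := if t < 0 then Real.log (-t) else 0

/-- `T(x, y) = T₁(x - y)`. [folklore] -/
theorem upperLogKernel_eq (p : ℝ × ℝ) : upperLogKernel p = upperLogKernel₁ (p.1 - p.2) := by
  simp only [upperLogKernel, upperLogKernel₁, sub_neg, neg_sub]

/-- `T₁` is measurable. [folklore] -/
theorem measurable_upperLogKernel₁ : Measurable upperLogKernel₁ :=
  Measurable.ite (measurableSet_lt measurable_id measurable_const)
    (Real.measurable_log.comp measurable_neg) measurable_const

/-- `T` is measurable. [folklore] -/
theorem measurable_upperLogKernel : Measurable upperLogKernel := by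
  have : upperLogKernel = fun p => upperLogKernel₁ (p.1 - p.2) := funext upperLogKernel_eq
  rw [this]
  exact measurable_upperLogKernel₁.comp (measurable_fst.sub measurable_snd)

/-- `T` vanishes off the wedge `x < y`. [folklore] -/
theorem upperLogKernel_of_not_lt {p : ℝ × ℝ} (h : ¬ p.1 < p.2) : upperLogKernel p = 0 := by
  simp [upperLogKernel, h]

/-- `T` restricted to differences is integrable on bounded intervals (a truncated `log`).
[folklore] -/
theorem integrableOn_upperLogKernel₁ (a b : ℝ) (hab : a ≤ b) : IntegrableOn upperLogKernel₁ (Icc a b) := by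
  have h : upperLogKernel₁ = (Iio 0).indicator fun t => Real.log (-t) := by
    ext t; simp [upperLogKernel₁, indicator]
  rw [h]
  refine IntegrableOn.indicator ?_ measurableSet_Iio
  refine integrableOn_Icc_of_intervalIntegrable hab ?_
  have h2 := (intervalIntegrable_log' (a := -a) (b := -b)).comp_sub_left 0
  simp only [zero_sub, neg_neg] at h2
  exact h2

/-- **Integrability of `T(x,y) φ(x) χ(y)`** for bounded measurable `φ` vanishing on `(-∞, -L)`
and `χ` vanishing on `(L, ∞)` (the wedge `x < y` then confines the support to `[-L, L]²`).
[folklore] -/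
theorem integrable_upperLogKernel_mul_mul {φ χ : ℝ → ℝ} {C L : ℝ} (hφm : Measurable φ)
    (hχm : Measurable χ) (hφC : ∀ x, |φ x| ≤ C) (hχC : ∀ y, |χ y| ≤ C)
    (hφ0 : ∀ x, x < -L → φ x = 0) (hχ0 : ∀ y, L < y → χ y = 0) (hL : 0 ≤ L) :
    Integrable (fun p : ℝ × ℝ => upperLogKernel p * φ p.1 * χ p.2) := by
  have hC0 : 0 ≤ C := (abs_nonneg _).trans (hφC 0)
  set φ' : ℝ → ℝ := fun x => if x ∈ Icc (-L) L then φ x else 0 with hφ'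
  set χ' : ℝ → ℝ := fun y => if y ∈ Icc (-L) L then χ y else 0 with hχ'
  have hpt : ∀ p : ℝ × ℝ, upperLogKernel p * φ p.1 * χ p.2 =
      φ' p.1 * χ' p.2 * upperLogKernel₁ (p.1 - p.2) := by
    rintro ⟨x, y⟩
    simp only [hφ', hχ']
    rw [show upperLogKernel₁ (x - y) = upperLogKernel (x, y) from (upperLogKernel_eq (x, y)).symm]
    by_cases hxy : x < y
    · by_cases hx : x ∈ Icc (-L) L
      · by_cases hy : y ∈ Icc (-L) L
        · rw [if_pos hx, if_pos hy]; ring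
        · rw [if_neg hy]
          have : χ y = 0 := by
            rcases not_and_or.mp hy with h | h
            · exact absurd (le_trans hx.1 hxy.le) h
            · exact hχ0 y (not_le.mp h)
          rw [this]; ring
      · rw [if_neg hx]
        have : φ x = 0 ∨ χ y = 0 := by
          rcases not_and_or.mp hx with h | h
          · exact Or.inl (hφ0 x (not_le.mp h))
          · exact Or.inr (hχ0 y (lt_of_lt_of_le' hxy (not_le.mp h).le))
        rcases this with h | h <;> simp [h]
    · rw [upperLogKernel_of_not_lt (by exact hxy)]; ring
  simp_rw [hpt]
  have hm' : ∀ {g : ℝ → ℝ}, Measurable g → Measurable fun x => if x ∈ Icc (-L) L then g x else 0 :=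
    fun hg => Measurable.ite measurableSet_Icc hg measurable_const
  have hb' : ∀ {g : ℝ → ℝ}, (∀ x, |g x| ≤ C) → ∀ x, |(if x ∈ Icc (-L) L then g x else 0)| ≤ C :=
    fun hg x => by split_ifs <;> simp [hg x, hC0]
  have h := integrable_mul_mul_kernel (C := C) (L := L) (hm' hφm) (hm' hχm)
    measurable_upperLogKernel₁ (hb' hφC) (hb' hχC) (fun x hx => if_neg hx) (fun x hx => if_neg hx)
    (integrableOn_upperLogKernel₁ _ _ (by linarith))
  rw [Measure.volume_eq_prod]
  exact h

/-- The inner integral: `∫ T(x, y) 1{y < d} dy = Λ((d - x)₊)`. [folklore] -/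
theorem integral_upperLogKernel_mul_ite_lt (x d : ℝ) :
    ∫ y, upperLogKernel (x, y) * (if y < d then (1:ℝ) else 0) = logPrim (max (d - x) 0) := by
  have h : (fun y => upperLogKernel (x, y) * (if y < d then (1:ℝ) else 0)) =
      (Ioo x d).indicator fun y => Real.log (y - x) := by
    ext y
    simp only [upperLogKernel, indicator, mem_Ioo]
    by_cases h1 : x < y <;> by_cases h2 : y < d <;> simp [h1, h2]
  rw [h, MeasureTheory.integral_indicator measurableSet_Ioo]
  rcases lt_or_ge x d with hxd | hdx
  · rw [← integral_Ioc_eq_integral_Ioo, ← integral_of_le hxd.le, integral_log_sub_eq_logPrim,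
      max_eq_left (by linarith)]
  · rw [Ioo_eq_empty (not_lt.mpr hdx), Measure.restrict_empty, integral_zero_measure,
      max_eq_right (by linarith), logPrim_zero]

/-- **The hook form against an averaged indicator (Fubini).** For a bounded measurable `φ`
vanishing off `[-L, L]` and `a > 0`:
`∬ T(x,y) φ(x) (∫_0^π 1{y < a cos β} dβ) dx dy = ∫_0^π (∫ φ(x) Λ((a cos β - x)₊) dx) dβ`.
[folklore] -/
theorem integral_upperLogKernel_mul_avgIndicator {φ : ℝ → ℝ} {C L a : ℝ} (hφm : Measurable φ)
    (hφC : ∀ x, |φ x| ≤ C) (hφ0 : ∀ x ∉ Icc (-L) L, φ x = 0) (hL : 0 ≤ L) (ha : 0 < a) :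
    ∫ p : ℝ × ℝ, upperLogKernel p * φ p.1 *
        (∫ β in (0:ℝ)..π, if p.2 < a * Real.cos β then (1:ℝ) else 0) =
      ∫ β in (0:ℝ)..π, ∫ x, φ x * logPrim (max (a * Real.cos β - x) 0) := by
  have hπ := Real.pi_pos
  have hC0 : 0 ≤ C := (abs_nonneg _).trans (hφC 0)
  set L' : ℝ := max L a with hL'
  have hLL' : L ≤ L' := le_max_left _ _
  have haL' : a ≤ L' := le_max_right _ _
  -- the integrand on `(ℝ × ℝ) × ℝ`
  set G : ℝ × ℝ → ℝ → ℝ := fun p β =>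
    upperLogKernel p * φ p.1 * (if p.2 < a * Real.cos β then (1:ℝ) else 0) with hG
  have hstep1 : ∀ p : ℝ × ℝ, upperLogKernel p * φ p.1 *
      (∫ β in (0:ℝ)..π, if p.2 < a * Real.cos β then (1:ℝ) else 0) =
        ∫ β in Ioc (0:ℝ) π, G p β := by
    intro p
    rw [integral_of_le hπ.le, ← MeasureTheory.integral_const_mul]
  simp_rw [hstep1]
  -- measurability of `uncurry G`
  have hGm : Measurable (Function.uncurry G) := by
    refine ((measurable_upperLogKernel.comp measurable_fst).mul
      (hφm.comp (measurable_fst.comp measurable_fst))).mul ?_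
    refine Measurable.ite ?_ measurable_const measurable_const
    exact measurableSet_lt (measurable_snd.comp measurable_fst)
      ((Real.continuous_cos.measurable.comp measurable_snd).const_mul a)
  -- integrability on the product
  set C' : ℝ := max C π with hC'
  have hφabs_m : Measurable fun x => |φ x| := continuous_abs.measurable.comp hφm
  have hφabs_C : ∀ x, |(|φ x|)| ≤ C' := fun x => by rw [abs_abs]; exact (hφC x).trans (le_max_left _ _)
  have hφabs_0 : ∀ x, x < -L' → |φ x| = 0 := fun x hx => by
    rw [hφ0 x fun h => by linarith [h.1], abs_zero]
  have hφ_0 : ∀ x, x < -L' → φ x = 0 := fun x hx => hφ0 x fun h => by linarith [h.1]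
  have hφ_C : ∀ x, |φ x| ≤ C' := fun x => (hφC x).trans (le_max_left _ _)
  have hGint : Integrable (Function.uncurry G) (volume.prod (volume.restrict (Ioc (0:ℝ) π))) := by
    rw [integrable_prod_iff hGm.aestronglyMeasurable]
    constructor
    · refine Eventually.of_forall fun p => ?_
      have h1 : Integrable (fun _ => (1:ℝ)) (volume.restrict (Ioc (0:ℝ) π)) :=
        integrableOn_const (by simp)
      have h2 : Integrable (fun β => if p.2 < a * Real.cos β then (1:ℝ) else 0)
          (volume.restrict (Ioc (0:ℝ) π)) := by
        refine h1.mono' (Measurable.ite (measurableSet_lt measurable_const (by fun_prop))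
          measurable_const measurable_const).aestronglyMeasurable (Eventually.of_forall fun β => ?_)
        split_ifs <;> simp
      exact h2.const_mul (upperLogKernel p * φ p.1)
    · have heq : (fun p : ℝ × ℝ => ∫ β, ‖Function.uncurry G (p, β)‖ ∂(volume.restrict (Ioc (0:ℝ) π)))
          = fun p => ‖upperLogKernel p * |φ p.1| * (π * (1 - arcsineCDF a p.2))‖ := by
        ext p
        have h1 : ∀ β, ‖Function.uncurry G (p, β)‖ =
            |upperLogKernel p * φ p.1| * (if p.2 < a * Real.cos β then (1:ℝ) else 0) := by
          intro β
          simp only [Function.uncurry_apply_pair, hG]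
          rw [Real.norm_eq_abs, abs_mul (upperLogKernel p * φ p.1)]
          congr 1
          split_ifs <;> simp
        simp_rw [h1]
        rw [MeasureTheory.integral_const_mul, ← integral_of_le hπ.le, integral_ite_lt_mul_cos ha,
          norm_mul, norm_mul, Real.norm_eq_abs, Real.norm_eq_abs, Real.norm_eq_abs, abs_abs,
          abs_mul, abs_of_nonneg (mul_nonneg hπ.le (sub_nonneg.mpr (arcsineCDF_le_one a p.2)))]
      rw [heq]
      refine (integrable_upperLogKernel_mul_mul (C := C') (L := L')
        (χ := fun y => π * (1 - arcsineCDF a y)) hφabs_m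
        (measurable_const.mul (measurable_const.sub (continuous_arcsineCDF a).measurable))
        hφabs_C (fun y => ?_) hφabs_0 (fun y hy => ?_) (hL.trans hLL')).norm
      · rw [abs_of_nonneg (mul_nonneg hπ.le (sub_nonneg.mpr (arcsineCDF_le_one a y)))]
        calc π * (1 - arcsineCDF a y) ≤ π * 1 :=
              mul_le_mul_of_nonneg_left (by linarith [arcsineCDF_nonneg a y]) hπ.le
          _ ≤ C' := by rw [mul_one]; exact le_max_right _ _
      · rw [arcsineCDF_of_le ha (haL'.trans hy.le), sub_self, mul_zero]
  rw [integral_integral_swap hGint, ← integral_of_le hπ.le]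
  refine integral_congr fun β _ => ?_
  -- the inner `p`-integral for fixed `β`
  have hcos : a * Real.cos β ≤ L' := (mul_le_of_le_one_right ha.le (Real.cos_le_one β)).trans haL'
  have hint : Integrable (fun p : ℝ × ℝ => G p β) (volume.prod volume) := by
    have h := integrable_upperLogKernel_mul_mul (C := max C' 1) (L := L')
      (χ := fun y => if y < a * Real.cos β then (1:ℝ) else 0) hφm
      (Measurable.ite (measurableSet_lt measurable_id measurable_const) measurable_const
        measurable_const) (fun x => (hφ_C x).trans (le_max_left _ _)) (fun y => ?_) hφ_0
      (fun y hy => ?_) (hL.trans hLL')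
    · rw [Measure.volume_eq_prod] at h; exact h
    · split_ifs <;> simp
    · exact if_neg (not_lt.mpr (hcos.trans hy.le))
  rw [Measure.volume_eq_prod, integral_prod _ hint]
  refine integral_congr_ae (Eventually.of_forall fun x => ?_)
  simp only [hG]
  have h1 : ∀ y, upperLogKernel (x, y) * φ x * (if y < a * Real.cos β then (1:ℝ) else 0) =
      φ x * (upperLogKernel (x, y) * (if y < a * Real.cos β then (1:ℝ) else 0)) := fun y => by ring
  simp_rw [h1]
  rw [MeasureTheory.integral_const_mul, integral_upperLogKernel_mul_ite_lt]

/-! ### Iterated interval integrals of continuous functions on a square -/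

/-- Fubini for a continuous function on `[a, b]²`, in interval-integral form. [folklore] -/
theorem intervalIntegral_swap_of_continuous {f : ℝ → ℝ → ℝ}
    (hf : Continuous (Function.uncurry f)) {a b : ℝ} (hab : a ≤ b) :
    ∫ x in a..b, ∫ y in a..b, f x y = ∫ y in a..b, ∫ x in a..b, f x y := by
  have hint : Integrable (Function.uncurry f)
      ((volume.restrict (Ioc a b)).prod (volume.restrict (Ioc a b))) := by
    rw [Measure.prod_restrict, ← Measure.volume_eq_prod]
    exact (hf.continuousOn.integrableOn_compact (isCompact_Icc.prod isCompact_Icc)).mono_set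
      (prod_mono Ioc_subset_Icc_self Ioc_subset_Icc_self)
  have h := integral_integral_swap hint
  simp only [integral_of_le hab]
  exact h

/-- Continuous functions of two real variables are interval-integrable in each variable.
[folklore] -/
theorem intervalIntegrable_of_continuous_uncurry_left {f : ℝ → ℝ → ℝ}
    (hf : Continuous (Function.uncurry f)) (x a b : ℝ) :
    IntervalIntegrable (f x) volume a b :=
  (hf.comp (Continuous.prodMk_right x)).intervalIntegrable _ _

/-! ### The hook energy of the arcsine law: `𝔅(F_a, 1 - F_a) = (a²/4)(log (a/2) - 1/2)` -/

/-- Inner-inner integral: `∫ 1{c ≤ x} Λ((d - x)₊) dx = Λ₂((d - c)₊)`. [folklore] -/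
theorem integral_ite_le_mul_logPrim (c d : ℝ) :
    ∫ x, (if c ≤ x then (1:ℝ) else 0) * logPrim (max (d - x) 0) = logPrim₂ (max (d - c) 0) := by
  have h : (fun x => (if c ≤ x then (1:ℝ) else 0) * logPrim (max (d - x) 0)) =
      (Ico c d).indicator fun x => logPrim (d - x) := by
    ext x
    simp only [indicator, mem_Ico]
    by_cases h1 : c ≤ x
    · by_cases h2 : x < d
      · simp [h1, h2, max_eq_left (sub_nonneg.mpr h2.le)]
      · simp [h1, h2, max_eq_right (sub_nonpos.mpr (not_lt.mp h2))]
    · simp [h1]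
  rw [h, MeasureTheory.integral_indicator measurableSet_Ico]
  rcases lt_or_ge c d with hcd | hdc
  · rw [integral_Ico_eq_integral_Ioo, ← integral_Ioc_eq_integral_Ioo, ← integral_of_le hcd.le,
      integral_logPrim_sub c d hcd.le, max_eq_left (by linarith)]
  · rw [Ico_eq_empty (not_lt.mpr hdc), Measure.restrict_empty, integral_zero_measure,
      max_eq_right (by linarith), logPrim₂_zero]

/-- Inner integral: for `|d| ≤ a`,
`∫ F_a(x) 1{x ≤ a} Λ((d - x)₊) dx = π⁻¹ ∫_0^π Λ₂((d - a cos α)₊) dα`. [folklore] -/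
theorem integral_arcsineCDF_mul_logPrim {a d : ℝ} (ha : 0 < a) (hd : d ≤ a) :
    ∫ x, (if x ≤ a then arcsineCDF a x else 0) * logPrim (max (d - x) 0) =
      π⁻¹ * ∫ α in (0:ℝ)..π, logPrim₂ (max (d - a * Real.cos α) 0) := by
  have hπ := Real.pi_pos
  -- replace the truncated `F` by `π⁻¹ ∫ 1{a cos α ≤ x} dα`
  have h1 : ∀ x, (if x ≤ a then arcsineCDF a x else 0) * logPrim (max (d - x) 0) =
      π⁻¹ * ∫ α in Ioc (0:ℝ) π, (if a * Real.cos α ≤ x then (1:ℝ) else 0) * logPrim (max (d - x) 0) := by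
    intro x
    rw [MeasureTheory.integral_mul_const, ← integral_of_le hπ.le, integral_ite_mul_cos_le ha]
    by_cases hx : x ≤ a
    · rw [if_pos hx]; field_simp
    · rw [if_neg hx, max_eq_right (by linarith), logPrim_zero]; ring
  simp_rw [h1]
  rw [MeasureTheory.integral_const_mul]
  congr 1
  -- Fubini on `ℝ × (0, π]` for a bounded integrand supported in `[-a, a] × (0, π]`
  set G : ℝ → ℝ → ℝ := fun x α =>
    (if a * Real.cos α ≤ x then (1:ℝ) else 0) * logPrim (max (d - x) 0) with hG
  obtain ⟨M, hM⟩ : ∃ M, ∀ u ∈ Icc (0:ℝ) (2 * a), |logPrim u| ≤ M := by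
    obtain ⟨M, hM⟩ := isCompact_Icc.exists_bound_of_continuousOn
      (continuous_logPrim.continuousOn (s := Icc (0:ℝ) (2 * a)))
    exact ⟨M, fun u hu => by simpa [Real.norm_eq_abs] using hM u hu⟩
  have hM0 : 0 ≤ M := (abs_nonneg _).trans (hM 0 ⟨le_rfl, by linarith⟩)
  have hGm : Measurable (Function.uncurry G) := by
    refine Measurable.mul (Measurable.ite ?_ measurable_const measurable_const)
      (continuous_logPrim.measurable.comp ((measurable_const.sub measurable_fst).max measurable_const))
    exact measurableSet_le ((Real.continuous_cos.measurable.comp measurable_snd).const_mul a)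
      measurable_fst
  have hGbound : ∀ z : ℝ × ℝ, |Function.uncurry G z| ≤ M := by
    rintro ⟨x, α⟩
    simp only [Function.uncurry_apply_pair, hG, abs_mul]
    by_cases hx : d - x ≤ 2 * a ∧ 0 ≤ d - x
    · calc |(if a * Real.cos α ≤ x then (1:ℝ) else 0)| * |logPrim (max (d - x) 0)| ≤ 1 * M := by
            refine mul_le_mul ?_ ?_ (abs_nonneg _) zero_le_one
            · split_ifs <;> simp
            · rw [max_eq_left hx.2]; exact hM _ ⟨hx.2, hx.1⟩
        _ = M := one_mul M
    · rcases not_and_or.mp hx with h | h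
      · -- `x < d - 2a ≤ -a`, so `a cos α ≤ x` fails
        have : ¬ a * Real.cos α ≤ x := by
          intro h'
          have := Real.neg_one_le_cos α
          nlinarith
        simp [this, hM0]
      · rw [max_eq_right (not_le.mp h).le, logPrim_zero]; simp [hM0]
  have hGint : Integrable (Function.uncurry G) (volume.prod (volume.restrict (Ioc (0:ℝ) π))) := by
    refine integrable_of_bounded_of_eq_zero_off (S := Icc (-a) a ×ˢ univ) hGm.aestronglyMeasurable
      (measurableSet_Icc.prod MeasurableSet.univ) ?_ hGbound ?_
    · rw [Measure.prod_prod]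
      simp [Real.volume_Icc, ENNReal.mul_eq_top]
    · rintro ⟨x, α⟩ hz
      simp only [mem_prod, mem_univ, and_true, mem_Icc, not_and_or, not_le] at hz
      simp only [Function.uncurry_apply_pair, hG]
      rcases hz with h | h
      · have : ¬ a * Real.cos α ≤ x := by
          intro h'
          have := Real.neg_one_le_cos α
          nlinarith
        simp [this]
      · rw [max_eq_right (by linarith), logPrim_zero, mul_zero]
  rw [integral_integral_swap hGint, ← integral_of_le hπ.le]
  refine integral_congr fun α _ => ?_
  exact integral_ite_le_mul_logPrim _ _

/-- **The hook form of the arcsine law as a trigonometric double integral**: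
`𝔅(F_a, 1 - F_a) = π⁻² ∫_0^π ∫_0^π Λ₂((a cos β - a cos α)₊) dα dβ`. [folklore] -/
theorem hookForm_arcsine_eq_double_integral {a : ℝ} (ha : 0 < a) :
    ∫ p : ℝ × ℝ, upperLogKernel p * arcsineCDF a p.1 * (1 - arcsineCDF a p.2) =
      (π ^ 2)⁻¹ * ∫ β in (0:ℝ)..π, ∫ α in (0:ℝ)..π,
        logPrim₂ (max (a * Real.cos β - a * Real.cos α) 0) := by
  have hπ := Real.pi_pos
  set φ : ℝ → ℝ := fun x => if x ≤ a then arcsineCDF a x else 0 with hφ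
  have hφm : Measurable φ :=
    Measurable.ite measurableSet_Iic (continuous_arcsineCDF a).measurable measurable_const
  have hφC : ∀ x, |φ x| ≤ 1 := fun x => by
    simp only [hφ]
    split_ifs
    · rw [abs_of_nonneg (arcsineCDF_nonneg a x)]; exact arcsineCDF_le_one a x
    · simp
  have hφ0 : ∀ x ∉ Icc (-a) a, φ x = 0 := fun x hx => by
    simp only [hφ]
    rcases not_and_or.mp hx with h | h
    · rw [arcsineCDF_of_le_neg ha (not_le.mp h).le]; simp
    · exact if_neg h
  -- pointwise rewriting of the integrand
  have hpt : ∀ p : ℝ × ℝ, upperLogKernel p * arcsineCDF a p.1 * (1 - arcsineCDF a p.2) =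
      π⁻¹ * (upperLogKernel p * φ p.1 *
        ∫ β in (0:ℝ)..π, if p.2 < a * Real.cos β then (1:ℝ) else 0) := by
    rintro ⟨x, y⟩
    simp only [hφ]
    rw [integral_ite_lt_mul_cos ha]
    by_cases hx : x ≤ a
    · rw [if_pos hx]; field_simp
    · rw [if_neg hx]
      by_cases hxy : x < y
      · rw [arcsineCDF_of_le ha (by linarith : a ≤ y)]; ring
      · rw [upperLogKernel_of_not_lt (by exact hxy)]; ring
  simp_rw [hpt]
  rw [MeasureTheory.integral_const_mul,
    integral_upperLogKernel_mul_avgIndicator hφm hφC hφ0 ha.le ha]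
  have hinner : ∀ β : ℝ, ∫ x, φ x * logPrim (max (a * Real.cos β - x) 0) =
      π⁻¹ * ∫ α in (0:ℝ)..π, logPrim₂ (max (a * Real.cos β - a * Real.cos α) 0) := fun β =>
    integral_arcsineCDF_mul_logPrim ha (mul_le_of_le_one_right ha.le (Real.cos_le_one β))
  simp_rw [hinner]
  rw [intervalIntegral.integral_const_mul]
  field_simp

/-! ### Evaluation of the trigonometric double integral -/

/-- `Λ₂(w₊) + Λ₂((-w)₊) = Λ₂(w)` (`Λ₂` is even under Lean's `log |·|` convention). [folklore] -/
theorem logPrim₂_posPart_add (w : ℝ) : logPrim₂ (max w 0) + logPrim₂ (max (-w) 0) = logPrim₂ w := by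
  rcases le_total 0 w with hw | hw
  · rw [max_eq_left hw, max_eq_right (by linarith), logPrim₂_zero, add_zero]
  · rw [max_eq_right hw, max_eq_left (by linarith), logPrim₂_zero, zero_add, logPrim₂, logPrim₂,
      Real.log_neg_eq_log]
    ring

/-- `∫_0^π cos² = π/2`. [folklore] -/
theorem integral_cos_sq_zero_pi : ∫ x in (0:ℝ)..π, Real.cos x ^ 2 = π / 2 := by
  rw [integral_cos_sq]; simp

/-- `∫_0^π cos = 0`. [folklore] -/
theorem integral_cos_zero_pi : ∫ x in (0:ℝ)..π, Real.cos x = 0 := by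
  rw [integral_cos]; simp

/-- `∫_0^π ∫_0^π (a cos β - a cos α)² dα dβ = π² a²`. [folklore] -/
theorem integral_integral_sq_cos_sub_cos (a : ℝ) :
    ∫ β in (0:ℝ)..π, ∫ α in (0:ℝ)..π, (a * Real.cos β - a * Real.cos α) ^ 2 = π ^ 2 * a ^ 2 := by
  have hinner : ∀ β : ℝ, ∫ α in (0:ℝ)..π, (a * Real.cos β - a * Real.cos α) ^ 2 =
      a ^ 2 * (π * Real.cos β ^ 2 + π / 2) := by
    intro β
    have h : ∀ α : ℝ, (a * Real.cos β - a * Real.cos α) ^ 2 =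
        a ^ 2 * Real.cos β ^ 2 - 2 * a ^ 2 * Real.cos β * Real.cos α + a ^ 2 * Real.cos α ^ 2 := by
      intro α; ring
    simp_rw [h]
    rw [intervalIntegral.integral_add ((intervalIntegrable_const).sub
      (Continuous.intervalIntegrable (by fun_prop) _ _)) (Continuous.intervalIntegrable (by fun_prop) _ _),
      intervalIntegral.integral_sub intervalIntegrable_const (Continuous.intervalIntegrable (by fun_prop) _ _),
      intervalIntegral.integral_const, intervalIntegral.integral_const_mul, intervalIntegral.integral_const_mul,
      integral_cos_zero_pi, integral_cos_sq_zero_pi]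
    simp only [sub_zero, smul_eq_mul]
    ring
  simp_rw [hinner]
  rw [intervalIntegral.integral_const_mul, intervalIntegral.integral_add
    (Continuous.intervalIntegrable (by fun_prop) _ _) intervalIntegrable_const,
    intervalIntegral.integral_const_mul, integral_cos_sq_zero_pi, intervalIntegral.integral_const]
  simp only [sub_zero, smul_eq_mul]
  ring

/-- For `|x| ≤ a` (`a > 0`): `∫_0^π (x - a cos α) log (x - a cos α) dα = π x (log (a/2) + 1)`
(the potential and the first moment of the arcsine law). [folklore] -/
theorem integral_sub_mul_log_sub_mul_cos {x a : ℝ} (ha : 0 < a) (hx : |x| ≤ a) :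
    ∫ α in (0:ℝ)..π, (x - a * Real.cos α) * Real.log (x - a * Real.cos α) =
      π * x * (Real.log (a / 2) + 1) := by
  have h : ∀ α : ℝ, (x - a * Real.cos α) * Real.log (x - a * Real.cos α) =
      x * Real.log |x - a * Real.cos α| - a * (Real.cos α * Real.log |x - a * Real.cos α|) := by
    intro α; rw [Real.log_abs]; ring
  simp_rw [h]
  have hi1 := intervalIntegrable_log_abs_sub_mul_cos_zero_pi ha x
  have hi2 : IntervalIntegrable (fun α => Real.cos α * Real.log |x - a * Real.cos α|) volume 0 π :=
    hi1.continuousOn_mul (by fun_prop)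
  rw [intervalIntegral.integral_sub (hi1.const_mul x) (hi2.const_mul a),
    intervalIntegral.integral_const_mul, intervalIntegral.integral_const_mul,
    integral_log_abs_sub_mul_cos_zero_pi ha hx, integral_cos_mul_log_abs_sub_mul_cos ha hx]
  field_simp
  ring

/-- `∫_0^π ∫_0^π w · (w log w) dα dβ = π² a² (log (a/2) + 1)`, `w = a cos β - a cos α`
(antisymmetry of `w` under `α ↔ β` reduces it to `2 ∫ a cos β ∫ w log w`). [folklore] -/
theorem integral_integral_mul_mul_log_cos_sub_cos {a : ℝ} (ha : 0 < a) :
    ∫ β in (0:ℝ)..π, ∫ α in (0:ℝ)..π, (a * Real.cos β - a * Real.cos α) *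
        ((a * Real.cos β - a * Real.cos α) * Real.log (a * Real.cos β - a * Real.cos α)) =
      π ^ 2 * a ^ 2 * (Real.log (a / 2) + 1) := by
  have hπ := Real.pi_pos
  set m : ℝ → ℝ := fun u => u * Real.log u with hm
  have hmc : Continuous m := Real.continuous_mul_log
  have hmodd : ∀ u, m (-u) = -m u := fun u => by simp [hm, Real.log_neg_eq_log]
  -- the two pieces `a cos β · m(w)` and `a cos α · m(w)`
  set f : ℝ → ℝ → ℝ := fun β α => a * Real.cos β * m (a * Real.cos β - a * Real.cos α) with hf
  set g : ℝ → ℝ → ℝ := fun β α => a * Real.cos α * m (a * Real.cos β - a * Real.cos α) with hg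
  have hfc : Continuous (Function.uncurry f) := by
    simp only [hf]
    exact ((continuous_const.mul (Real.continuous_cos.comp continuous_fst))).mul
      (hmc.comp ((Real.continuous_cos.comp continuous_fst).const_mul a |>.sub
        ((Real.continuous_cos.comp continuous_snd).const_mul a)))
  have hgc : Continuous (Function.uncurry g) := by
    simp only [hg]
    exact ((continuous_const.mul (Real.continuous_cos.comp continuous_snd))).mul
      (hmc.comp ((Real.continuous_cos.comp continuous_fst).const_mul a |>.sub
        ((Real.continuous_cos.comp continuous_snd).const_mul a)))
  have hsplit : ∀ β α, (a * Real.cos β - a * Real.cos α) *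
      ((a * Real.cos β - a * Real.cos α) * Real.log (a * Real.cos β - a * Real.cos α)) =
        f β α - g β α := by
    intro β α; simp only [hf, hg, hm]; ring
  simp_rw [hsplit]
  -- antisymmetry: `∫∫ g = -∫∫ f`
  have hanti : ∫ β in (0:ℝ)..π, ∫ α in (0:ℝ)..π, g β α = -∫ β in (0:ℝ)..π, ∫ α in (0:ℝ)..π, f β α := by
    rw [intervalIntegral_swap_of_continuous hgc hπ.le, ← intervalIntegral.integral_neg]
    refine integral_congr fun β _ => ?_
    rw [← intervalIntegral.integral_neg]
    refine integral_congr fun α _ => ?_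
    simp only [hf, hg]
    rw [show a * Real.cos α - a * Real.cos β = -(a * Real.cos β - a * Real.cos α) by ring, hmodd]
    ring
  have hIf : ∀ β, IntervalIntegrable (f β) volume 0 π := fun β =>
    intervalIntegrable_of_continuous_uncurry_left hfc β _ _
  have hIg : ∀ β, IntervalIntegrable (g β) volume 0 π := fun β =>
    intervalIntegrable_of_continuous_uncurry_left hgc β _ _
  have h1 : ∫ β in (0:ℝ)..π, ∫ α in (0:ℝ)..π, (f β α - g β α) =
      (∫ β in (0:ℝ)..π, ∫ α in (0:ℝ)..π, f β α) - ∫ β in (0:ℝ)..π, ∫ α in (0:ℝ)..π, g β α := by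
    rw [← intervalIntegral.integral_sub
      ((continuous_parametric_intervalIntegral_of_continuous' hfc 0 π).intervalIntegrable _ _)
      ((continuous_parametric_intervalIntegral_of_continuous' hgc 0 π).intervalIntegrable _ _)]
    exact integral_congr fun β _ => intervalIntegral.integral_sub (hIf β) (hIg β)
  rw [h1, hanti, sub_neg_eq_add]
  -- `∫ α, f β α = a cos β · π (a cos β)(log (a/2) + 1)`
  have hinner : ∀ β, ∫ α in (0:ℝ)..π, f β α =
      π * a ^ 2 * (Real.log (a / 2) + 1) * Real.cos β ^ 2 := by
    intro β
    simp only [hf, hm]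
    rw [intervalIntegral.integral_const_mul, integral_sub_mul_log_sub_mul_cos ha
      (by rw [abs_mul, abs_of_pos ha]; exact mul_le_of_le_one_right ha.le (Real.abs_cos_le_one β))]
    ring
  simp_rw [hinner]
  rw [intervalIntegral.integral_const_mul, integral_cos_sq_zero_pi]
  ring

/-- `∫_0^π ∫_0^π Λ₂(a cos β - a cos α) dα dβ = π² a² (½ log (a/2) - ¼)`. [folklore] -/
theorem integral_integral_logPrim₂_cos_sub_cos {a : ℝ} (ha : 0 < a) :
    ∫ β in (0:ℝ)..π, ∫ α in (0:ℝ)..π, logPrim₂ (a * Real.cos β - a * Real.cos α) =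
      π ^ 2 * a ^ 2 * (Real.log (a / 2) / 2 - 1 / 4) := by
  have hπ := Real.pi_pos
  set w : ℝ → ℝ → ℝ := fun β α => a * Real.cos β - a * Real.cos α with hw
  have hwc : Continuous (Function.uncurry w) := by
    simp only [hw]; fun_prop
  set f : ℝ → ℝ → ℝ := fun β α => w β α * (w β α * Real.log (w β α)) with hf
  set g : ℝ → ℝ → ℝ := fun β α => (w β α) ^ 2 with hg
  have hfc : Continuous (Function.uncurry f) := by
    have : Function.uncurry f = fun z => Function.uncurry w z *
        (Function.uncurry w z * Real.log (Function.uncurry w z)) := by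
      ext ⟨β, α⟩; rfl
    rw [this]
    exact hwc.mul (Real.continuous_mul_log.comp hwc)
  have hgc : Continuous (Function.uncurry g) := by
    have : Function.uncurry g = fun z => (Function.uncurry w z) ^ 2 := by ext ⟨β, α⟩; rfl
    rw [this]; exact hwc.pow 2
  have hsplit : ∀ β α, logPrim₂ (a * Real.cos β - a * Real.cos α) = (1 / 2) * f β α - (3 / 4) * g β α := by
    intro β α; simp only [hf, hg, hw, logPrim₂]; ring
  simp_rw [hsplit]
  have hIf : ∀ β, IntervalIntegrable (fun α => (1 / 2) * f β α) volume 0 π := fun β =>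
    (intervalIntegrable_of_continuous_uncurry_left hfc β _ _).const_mul _
  have hIg : ∀ β, IntervalIntegrable (fun α => (3 / 4) * g β α) volume 0 π := fun β =>
    (intervalIntegrable_of_continuous_uncurry_left hgc β _ _).const_mul _
  have h1 : ∫ β in (0:ℝ)..π, ∫ α in (0:ℝ)..π, ((1 / 2) * f β α - (3 / 4) * g β α) =
      (1 / 2) * (∫ β in (0:ℝ)..π, ∫ α in (0:ℝ)..π, f β α) -
        (3 / 4) * ∫ β in (0:ℝ)..π, ∫ α in (0:ℝ)..π, g β α := by
    rw [← intervalIntegral.integral_const_mul, ← intervalIntegral.integral_const_mul,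
      ← intervalIntegral.integral_sub
      (((continuous_parametric_intervalIntegral_of_continuous' hfc 0 π).intervalIntegrable _ _).const_mul _)
      (((continuous_parametric_intervalIntegral_of_continuous' hgc 0 π).intervalIntegrable _ _).const_mul _)]
    refine integral_congr fun β _ => ?_
    rw [intervalIntegral.integral_sub (hIf β) (hIg β), intervalIntegral.integral_const_mul,
      intervalIntegral.integral_const_mul]
  rw [h1]
  simp only [hf, hg, hw]
  rw [integral_integral_mul_mul_log_cos_sub_cos ha, integral_integral_sq_cos_sub_cos]
  ring

/-- `∫_0^π ∫_0^π Λ₂((a cos β - a cos α)₊) dα dβ = π² a² (¼ log (a/2) - ⅛)` (symmetrise).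
[folklore] -/
theorem integral_integral_logPrim₂_posPart {a : ℝ} (ha : 0 < a) :
    ∫ β in (0:ℝ)..π, ∫ α in (0:ℝ)..π, logPrim₂ (max (a * Real.cos β - a * Real.cos α) 0) =
      π ^ 2 * a ^ 2 * (Real.log (a / 2) / 4 - 1 / 8) := by
  have hπ := Real.pi_pos
  set f : ℝ → ℝ → ℝ := fun β α => logPrim₂ (max (a * Real.cos β - a * Real.cos α) 0) with hf
  set g : ℝ → ℝ → ℝ := fun β α => logPrim₂ (max (-(a * Real.cos β - a * Real.cos α)) 0) with hg
  have hfc : Continuous (Function.uncurry f) := by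
    simp only [hf]
    exact continuous_logPrim₂.comp ((((Real.continuous_cos.comp continuous_fst).const_mul a).sub
      ((Real.continuous_cos.comp continuous_snd).const_mul a)).max continuous_const)
  have hgc : Continuous (Function.uncurry g) := by
    simp only [hg]
    exact continuous_logPrim₂.comp ((((Real.continuous_cos.comp continuous_fst).const_mul a).sub
      ((Real.continuous_cos.comp continuous_snd).const_mul a)).neg.max continuous_const)
  -- `∫∫ g = ∫∫ f` by swapping the variables
  have hswap : ∫ β in (0:ℝ)..π, ∫ α in (0:ℝ)..π, g β α = ∫ β in (0:ℝ)..π, ∫ α in (0:ℝ)..π, f β α := by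
    rw [intervalIntegral_swap_of_continuous hgc hπ.le]
    refine integral_congr fun β _ => integral_congr fun α _ => ?_
    simp only [hf, hg, neg_sub]
  -- `∫∫ (f + g) = ∫∫ Λ₂(w)`
  have hsum : (∫ β in (0:ℝ)..π, ∫ α in (0:ℝ)..π, f β α) + ∫ β in (0:ℝ)..π, ∫ α in (0:ℝ)..π, g β α =
      ∫ β in (0:ℝ)..π, ∫ α in (0:ℝ)..π, logPrim₂ (a * Real.cos β - a * Real.cos α) := by
    rw [← intervalIntegral.integral_add
      ((continuous_parametric_intervalIntegral_of_continuous' hfc 0 π).intervalIntegrable _ _)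
      ((continuous_parametric_intervalIntegral_of_continuous' hgc 0 π).intervalIntegrable _ _)]
    refine integral_congr fun β _ => ?_
    rw [← intervalIntegral.integral_add (intervalIntegrable_of_continuous_uncurry_left hfc β _ _)
      (intervalIntegrable_of_continuous_uncurry_left hgc β _ _)]
    refine integral_congr fun α _ => ?_
    exact logPrim₂_posPart_add _
  rw [hswap, integral_integral_logPrim₂_cos_sub_cos ha] at hsum
  simp only [hf] at hsum
  linarith

/-- **The hook energy of the arcsine law.** For `a > 0`,
`∬_{x<y} log (y - x) F_a(x) (1 - F_a(y)) dx dy = (a²/4)(log (a/2) - ½)`; with `a = 2√N` this is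
Vershik–Kerov's value `½ (N log N - N)` of the hook integral at the limit shape `Ω_N`
(Vershik–Kerov 1985, Lemma 2; Logan–Shepp 1977). Proved here from the potential `log (a/2)` and the
first moment `-x` of the arcsine law, with no explicit double integration. [cite: VershikKerov1985, Lemma 2] -/
theorem hookForm_arcsine {a : ℝ} (ha : 0 < a) :
    ∫ p : ℝ × ℝ, upperLogKernel p * arcsineCDF a p.1 * (1 - arcsineCDF a p.2) =
      a ^ 2 / 4 * (Real.log (a / 2) - 1 / 2) := by
  rw [hookForm_arcsine_eq_double_integral ha, integral_integral_logPrim₂_posPart ha]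
  have hπ := Real.pi_pos
  field_simp
  ring

/-! ### Reflection symmetry of the hook kernel -/

/-- The reflection `(x, y) ↦ (-y, -x)` of the plane, a measurable equivalence. [folklore] -/
def reflEquiv : ℝ × ℝ ≃ᵐ ℝ × ℝ :=
  MeasurableEquiv.prodComm.trans ((MeasurableEquiv.neg ℝ).prodCongr (MeasurableEquiv.neg ℝ))

/-- The reflection acts as `(x, y) ↦ (-y, -x)`. [folklore] -/
theorem reflEquiv_apply (p : ℝ × ℝ) : reflEquiv p = (-p.2, -p.1) := rfl

/-- The reflection preserves Lebesgue measure. [folklore] -/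
theorem measurePreserving_reflEquiv : MeasurePreserving reflEquiv volume volume := by
  have h : MeasurePreserving (Prod.map Neg.neg Neg.neg ∘ Prod.swap)
      ((volume : Measure ℝ).prod volume) ((volume : Measure ℝ).prod volume) :=
    ((Measure.measurePreserving_neg volume).prod (Measure.measurePreserving_neg volume)).comp
      Measure.measurePreserving_swap
  rw [Measure.volume_eq_prod]
  exact h

/-- **Reflection symmetry of the hook form**: `𝔅(f, g) = 𝔅(g ∘ neg, f ∘ neg)`, i.e.
`∬ T(x,y) f(x) g(y) = ∬ T(x,y) g(-x) f(-y)` (the kernel `1{x<y} log (y-x)` is invariant under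
`(x, y) ↦ (-y, -x)`). [folklore] -/
theorem hookForm_refl (f g : ℝ → ℝ) :
    ∫ p : ℝ × ℝ, upperLogKernel p * f p.1 * g p.2 =
      ∫ p : ℝ × ℝ, upperLogKernel p * g (-p.1) * f (-p.2) := by
  rw [← measurePreserving_reflEquiv.integral_comp' (fun p : ℝ × ℝ => upperLogKernel p * g (-p.1) * f (-p.2))]
  refine integral_congr_ae (Eventually.of_forall fun p => ?_)
  simp only [reflEquiv_apply, neg_neg, upperLogKernel]
  by_cases h : p.1 < p.2
  · rw [if_pos h, if_pos (neg_lt_neg h), show -p.1 - -p.2 = p.2 - p.1 by ring]; ring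
  · rw [if_neg h, if_neg (fun h' => h (neg_lt_neg_iff.mp h'))]; ring

/-! ### Products of a compactly supported bounded density with a continuous two-variable function -/

/-- For a bounded measurable `η` vanishing off `[-L, L]` and a continuous `h : ℝ × ℝ → ℝ`, the
function `(β, x) ↦ η(x) h(β, x)` is integrable on `(0, π] × ℝ`. [folklore] -/
theorem integrable_mul_continuous_strip {η : ℝ → ℝ} {C L : ℝ} {h : ℝ → ℝ → ℝ}
    (hηm : Measurable η) (hηC : ∀ x, |η x| ≤ C) (hη0 : ∀ x ∉ Icc (-L) L, η x = 0)
    (hh : Continuous (Function.uncurry h)) :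
    Integrable (fun z : ℝ × ℝ => η z.2 * h z.1 z.2) ((volume.restrict (Ioc (0:ℝ) π)).prod volume) := by
  have hC0 : 0 ≤ C := (abs_nonneg _).trans (hηC 0)
  obtain ⟨M, hM⟩ : ∃ M, ∀ z ∈ Icc (0:ℝ) π ×ˢ Icc (-L) L, |Function.uncurry h z| ≤ M := by
    obtain ⟨M, hM⟩ := (isCompact_Icc.prod isCompact_Icc).exists_bound_of_continuousOn
      (hh.continuousOn (s := Icc (0:ℝ) π ×ˢ Icc (-L) L))
    exact ⟨M, fun z hz => by simpa [Real.norm_eq_abs] using hM z hz⟩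
  have hmeas : Measurable fun z : ℝ × ℝ => η z.2 * h z.1 z.2 := (hηm.comp measurable_snd).mul hh.measurable
  have hbox : IntegrableOn (fun z : ℝ × ℝ => η z.2 * h z.1 z.2) (Icc (0:ℝ) π ×ˢ Icc (-L) L)
      (volume.prod volume) := by
    have hfin : (volume.prod volume) (Icc (0:ℝ) π ×ˢ Icc (-L) L) ≠ ⊤ := by
      rw [Measure.prod_prod]; simp [Real.volume_Icc, ENNReal.mul_eq_top]
    refine Integrable.mono' (integrableOn_const (C := C * M) hfin) hmeas.aestronglyMeasurable ?_
    refine (ae_restrict_mem (measurableSet_Icc.prod measurableSet_Icc)).mono fun z hz => ?_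
    rw [Real.norm_eq_abs, abs_mul]
    exact mul_le_mul (hηC _) (hM z hz) (abs_nonneg _) hC0
  have h2 : IntegrableOn (fun z : ℝ × ℝ => η z.2 * h z.1 z.2) (Ioc (0:ℝ) π ×ˢ univ)
      (volume.prod volume) := by
    refine hbox.of_forall_sdiff_eq_zero (measurableSet_Ioc.prod MeasurableSet.univ) ?_
    rintro ⟨β, x⟩ ⟨hz1, hz2⟩
    simp only [mem_prod, mem_univ, and_true, mem_Ioc] at hz1
    have hx : x ∉ Icc (-L) L := fun hx => hz2 ⟨⟨hz1.1.le, hz1.2⟩, hx⟩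
    simp [hη0 x hx]
  rw [IntegrableOn, ← Measure.prod_restrict, Measure.restrict_univ] at h2
  exact h2

/-- Consequences: `β ↦ ∫ η(x) h(β, x) dx` is integrable on `(0, π]`, and Fubini holds.
[folklore] -/
theorem intervalIntegrable_integral_mul_continuous {η : ℝ → ℝ} {C L : ℝ} {h : ℝ → ℝ → ℝ}
    (hηm : Measurable η) (hηC : ∀ x, |η x| ≤ C) (hη0 : ∀ x ∉ Icc (-L) L, η x = 0)
    (hh : Continuous (Function.uncurry h)) :
    IntervalIntegrable (fun β => ∫ x, η x * h β x) volume 0 π := by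
  rw [intervalIntegrable_iff_integrableOn_Ioc_of_le Real.pi_pos.le]
  exact (integrable_mul_continuous_strip hηm hηC hη0 hh).integral_prod_left

/-- Fubini: `∫_0^π ∫ η(x) h(β,x) dx dβ = ∫ η(x) (∫_0^π h(β,x) dβ) dx`. [folklore] -/
theorem integral_integral_mul_continuous_swap {η : ℝ → ℝ} {C L : ℝ} {h : ℝ → ℝ → ℝ}
    (hηm : Measurable η) (hηC : ∀ x, |η x| ≤ C) (hη0 : ∀ x ∉ Icc (-L) L, η x = 0)
    (hh : Continuous (Function.uncurry h)) :
    ∫ β in (0:ℝ)..π, ∫ x, η x * h β x = ∫ x, η x * ∫ β in (0:ℝ)..π, h β x := by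
  rw [integral_of_le Real.pi_pos.le,
    integral_integral_swap (integrable_mul_continuous_strip hηm hηC hη0 hh)]
  refine integral_congr_ae (Eventually.of_forall fun x => ?_)
  simp only
  rw [MeasureTheory.integral_const_mul, integral_of_le Real.pi_pos.le]


/-- A bounded compactly supported density times a continuous function is integrable. [folklore] -/
theorem integrable_mul_continuous {η : ℝ → ℝ} {C L : ℝ} {g : ℝ → ℝ} (hηm : Measurable η)
    (hηC : ∀ x, |η x| ≤ C) (hη0 : ∀ x ∉ Icc (-L) L, η x = 0) (hg : Continuous g) :
    Integrable fun x => η x * g x := by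
  have hC0 : 0 ≤ C := (abs_nonneg _).trans (hηC 0)
  obtain ⟨M, hM⟩ : ∃ M, ∀ x ∈ Icc (-L) L, |g x| ≤ M := by
    obtain ⟨M, hM⟩ := isCompact_Icc.exists_bound_of_continuousOn (hg.continuousOn (s := Icc (-L) L))
    exact ⟨M, fun x hx => by simpa [Real.norm_eq_abs] using hM x hx⟩
  refine integrable_of_bounded_of_eq_zero_off (C := C * max M 0) (S := Icc (-L) L)
    (hηm.mul hg.measurable).aestronglyMeasurable measurableSet_Icc (by simp) (fun x => ?_) (fun x hx => ?_)
  · by_cases hx : x ∈ Icc (-L) L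
    · rw [abs_mul]; exact mul_le_mul (hηC x) ((hM x hx).trans (le_max_left _ _)) (abs_nonneg _) hC0
    · rw [hη0 x hx, zero_mul, abs_zero]; positivity
  · rw [hη0 x hx, zero_mul]

/-! ### The linear term of the expansion around the arcsine law -/

/-- **The arcsine linear potential** `Ψ_a(x) := π⁻¹ ∫_0^π Λ(a cos β - x) dβ = 𝔼 Λ(Y - x)`,
`Y ~` arcsine on `[-a, a]`, `Λ(u) = u log u - u`: the coefficient of the linear term of the
Vershik–Kerov hook integral expanded around the limit shape (its derivative is minus the
logarithmic potential of the arcsine law, `arcsineLinPot_sub`). [cite: VershikKerov1985, Lemma 2] -/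
def arcsineLinPot (a x : ℝ) : ℝ := π⁻¹ * ∫ β in (0:ℝ)..π, logPrim (a * Real.cos β - x)

/-- **The logarithmic potential of the arcsine law of `[-a, a]`**, `[0, π]`-parametrised:
`U_a(u) := π⁻¹ ∫_0^π log |u - a cos β| dβ` (`= log (a/2)` on the segment). [folklore] -/
def arcsinePot (a u : ℝ) : ℝ := π⁻¹ * ∫ β in (0:ℝ)..π, Real.log |u - a * Real.cos β|

/-- `U_a ≡ log (a/2)` on `[-a, a]`. [folklore] -/
theorem arcsinePot_eq_log {a u : ℝ} (ha : 0 < a) (hu : |u| ≤ a) : arcsinePot a u = Real.log (a / 2) := by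
  rw [arcsinePot, integral_log_abs_sub_mul_cos_zero_pi ha hu]
  field_simp

/-- `U_a ≥ log (a/2)` everywhere. [folklore] -/
theorem log_le_arcsinePot {a : ℝ} (ha : 0 < a) (u : ℝ) : Real.log (a / 2) ≤ arcsinePot a u := by
  rw [arcsinePot, le_inv_mul_iff₀ Real.pi_pos]
  exact pi_mul_log_half_le_integral_log_abs_sub_mul_cos_zero_pi ha u

/-- `Λ(u₊) - Λ((-u)₊) = Λ(u)`. [folklore] -/
theorem logPrim_posPart_sub (u : ℝ) : logPrim (max u 0) - logPrim (max (-u) 0) = logPrim u := by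
  rcases le_total 0 u with hu | hu
  · rw [max_eq_left hu, max_eq_right (by linarith), logPrim_zero, sub_zero]
  · rw [max_eq_right hu, max_eq_left (by linarith), logPrim_zero, zero_sub, logPrim_neg, neg_neg]

/-- **The linear term of the hook form is `∫ η Ψ_a`.** For a bounded measurable `η` vanishing off
`[-L, L]` and `a > 0`:
`𝔅(η, 1 - F_a) - 𝔅(F_a, η) = ∫ η(x) Ψ_a(x) dx`. (Reflection turns `𝔅(F_a, η)` into
`𝔅(η ∘ neg, 1 - F_a)`; both terms are then averaged-indicator forms.) [cite: VershikKerov1985, Lemma 2] -/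
theorem hookForm_linear_eq {η : ℝ → ℝ} {C L a : ℝ} (hηm : Measurable η)
    (hηC : ∀ x, |η x| ≤ C) (hη0 : ∀ x ∉ Icc (-L) L, η x = 0) (hL : 0 ≤ L) (ha : 0 < a) :
    (∫ p : ℝ × ℝ, upperLogKernel p * η p.1 * (1 - arcsineCDF a p.2)) -
        ∫ p : ℝ × ℝ, upperLogKernel p * arcsineCDF a p.1 * η p.2 =
      ∫ x, η x * arcsineLinPot a x := by
  have hπ := Real.pi_pos
  -- the reflected density
  set ηr : ℝ → ℝ := fun x => η (-x) with hηr
  have hηrm : Measurable ηr := hηm.comp measurable_neg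
  have hηrC : ∀ x, |ηr x| ≤ C := fun x => hηC (-x)
  have hηr0 : ∀ x ∉ Icc (-L) L, ηr x = 0 := fun x hx =>
    hη0 (-x) fun h => hx ⟨by linarith [h.2], by linarith [h.1]⟩
  -- both terms as averaged-indicator forms
  have hrep : ∀ y, 1 - arcsineCDF a y = π⁻¹ * ∫ β in (0:ℝ)..π, if y < a * Real.cos β then (1:ℝ) else 0 := by
    intro y; rw [integral_ite_lt_mul_cos ha]; field_simp
  have h1 : ∫ p : ℝ × ℝ, upperLogKernel p * η p.1 * (1 - arcsineCDF a p.2) =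
      π⁻¹ * ∫ β in (0:ℝ)..π, ∫ x, η x * logPrim (max (a * Real.cos β - x) 0) := by
    rw [← integral_upperLogKernel_mul_avgIndicator hηm hηC hη0 hL ha, ← MeasureTheory.integral_const_mul]
    refine integral_congr_ae (Eventually.of_forall fun p => ?_)
    simp only; rw [hrep]; ring
  have h2 : ∫ p : ℝ × ℝ, upperLogKernel p * arcsineCDF a p.1 * η p.2 =
      π⁻¹ * ∫ β in (0:ℝ)..π, ∫ x, η x * logPrim (max (x - a * Real.cos β) 0) := by
    rw [hookForm_refl]
    have h2a : ∫ p : ℝ × ℝ, upperLogKernel p * η (-p.1) * arcsineCDF a (-p.2) =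
        π⁻¹ * ∫ p : ℝ × ℝ, upperLogKernel p * ηr p.1 *
          ∫ β in (0:ℝ)..π, if p.2 < a * Real.cos β then (1:ℝ) else 0 := by
      rw [← MeasureTheory.integral_const_mul]
      refine integral_congr_ae (Eventually.of_forall fun p => ?_)
      simp only [hηr]; rw [arcsineCDF_neg, hrep]; ring
    rw [h2a, integral_upperLogKernel_mul_avgIndicator hηrm hηrC hηr0 hL ha]
    congr 1
    -- `x ↦ -x` inside, then `β ↦ π - β`
    have h2b : ∀ β, ∫ x, ηr x * logPrim (max (a * Real.cos β - x) 0) =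
        ∫ x, η x * logPrim (max (a * Real.cos β + x) 0) := by
      intro β
      simp only [hηr]
      rw [← integral_neg_eq_self (fun x => η x * logPrim (max (a * Real.cos β + x) 0)) volume]
      refine integral_congr_ae (Eventually.of_forall fun x => ?_)
      simp only; ring_nf
    simp_rw [h2b]
    set f : ℝ → ℝ := fun β => ∫ x, η x * logPrim (max (x - a * Real.cos β) 0) with hf
    calc ∫ β in (0:ℝ)..π, ∫ x, η x * logPrim (max (a * Real.cos β + x) 0)
        = ∫ β in (0:ℝ)..π, f (π - β) := by
          refine integral_congr fun β _ => ?_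
          simp only [hf, Real.cos_pi_sub]
          refine integral_congr_ae (Eventually.of_forall fun x => ?_)
          simp only; ring_nf
      _ = ∫ β in (π - π)..(π - 0), f β := intervalIntegral.integral_comp_sub_left f π
      _ = ∫ β in (0:ℝ)..π, f β := by simp
  -- continuity of the two kernels in `(β, x)`
  have hc1 : Continuous (Function.uncurry fun (β x : ℝ) => logPrim (max (a * Real.cos β - x) 0)) :=
    continuous_logPrim.comp ((((Real.continuous_cos.comp continuous_fst).const_mul a).sub
      continuous_snd).max continuous_const)
  have hc2 : Continuous (Function.uncurry fun (β x : ℝ) => logPrim (max (x - a * Real.cos β) 0)) :=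
    continuous_logPrim.comp ((continuous_snd.sub ((Real.continuous_cos.comp continuous_fst).const_mul a)).max
      continuous_const)
  have hc3 : Continuous (Function.uncurry fun (β x : ℝ) => logPrim (a * Real.cos β - x)) :=
    continuous_logPrim.comp (((Real.continuous_cos.comp continuous_fst).const_mul a).sub continuous_snd)
  rw [h1, h2, ← mul_sub, ← intervalIntegral.integral_sub
    (intervalIntegrable_integral_mul_continuous hηm hηC hη0 hc1)
    (intervalIntegrable_integral_mul_continuous hηm hηC hη0 hc2)]
  have h3 : ∀ β, (∫ x, η x * logPrim (max (a * Real.cos β - x) 0)) -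
      ∫ x, η x * logPrim (max (x - a * Real.cos β) 0) = ∫ x, η x * logPrim (a * Real.cos β - x) := by
    intro β
    have hi1 : Integrable (fun x => η x * logPrim (max (a * Real.cos β - x) 0)) :=
      integrable_mul_continuous hηm hηC hη0
        (continuous_logPrim.comp ((continuous_const.sub continuous_id).max continuous_const))
    have hi2 : Integrable (fun x => η x * logPrim (max (x - a * Real.cos β) 0)) :=
      integrable_mul_continuous hηm hηC hη0
        (continuous_logPrim.comp ((continuous_id.sub continuous_const).max continuous_const))
    rw [← MeasureTheory.integral_sub hi1 hi2]
    refine integral_congr_ae (Eventually.of_forall fun x => ?_)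
    simp only
    rw [← mul_sub, show x - a * Real.cos β = -(a * Real.cos β - x) by ring, logPrim_posPart_sub]
  simp_rw [h3]
  rw [integral_integral_mul_continuous_swap hηm hηC hη0 hc3, ← MeasureTheory.integral_const_mul]
  refine integral_congr_ae (Eventually.of_forall fun x => ?_)
  simp only [arcsineLinPot]
  ring

/-! ### `Ψ_a' = -U_a`: the linear potential is a primitive of minus the logarithmic potential -/

/-- Integrability of `(β, u) ↦ log |u - a cos β|` on `(0, π] × (s₀, s₁]`. [folklore] -/
theorem integrable_log_abs_sub_mul_cos_prod {a s₀ s₁ : ℝ} (ha : 0 < a) (hs : s₀ ≤ s₁) :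
    Integrable (fun z : ℝ × ℝ => Real.log |z.2 - a * Real.cos z.1|)
      ((volume.restrict (Ioc (0:ℝ) π)).prod (volume.restrict (Ioc s₀ s₁))) := by
  have hmeas : Measurable fun z : ℝ × ℝ => Real.log |z.2 - a * Real.cos z.1| :=
    Real.measurable_log.comp (continuous_abs.measurable.comp
      (measurable_snd.sub ((Real.continuous_cos.measurable.comp measurable_fst).const_mul a)))
  rw [integrable_prod_iff hmeas.aestronglyMeasurable]
  constructor
  · refine Eventually.of_forall fun β => ?_
    have h : IntervalIntegrable (fun u => Real.log |u - a * Real.cos β|) volume s₀ s₁ := by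
      have h1 := (intervalIntegrable_log' (a := s₀ - a * Real.cos β) (b := s₁ - a * Real.cos β)).comp_sub_right
        (a * Real.cos β)
      simp only [sub_add_cancel] at h1
      exact (h1.congr fun u _ => (Real.log_abs _).symm)
    exact (intervalIntegrable_iff_integrableOn_Ioc_of_le hs).mp h
  · set D : ℝ := max (|s₀|) (|s₁|) + a with hD
    set M : ℝ := ∫ u in (-D)..D, |Real.log u| with hM
    have hbound : ∀ β, ∫ u in Ioc s₀ s₁, ‖Real.log |u - a * Real.cos β|‖ ≤ M := by
      intro β
      have hc : |a * Real.cos β| ≤ a := by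
        rw [abs_mul, abs_of_pos ha]; exact mul_le_of_le_one_right ha.le (Real.abs_cos_le_one β)
      rw [← integral_of_le hs]
      simp only [Real.norm_eq_abs]
      refine integral_abs_log_abs_sub_le hs ?_ ?_
      · have := neg_abs_le s₀; have := (abs_le.mp hc).2; linarith [le_max_left (|s₀|) (|s₁|)]
      · have := le_abs_self s₁; have := (abs_le.mp hc).1; linarith [le_max_right (|s₀|) (|s₁|)]
    have h1 : Integrable (fun _ => M) (volume.restrict (Ioc (0:ℝ) π)) := integrableOn_const (by simp)
    refine h1.mono' hmeas.aestronglyMeasurable.norm.integral_prod_right' (Eventually.of_forall fun β => ?_)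
    rw [Real.norm_eq_abs, abs_of_nonneg (integral_nonneg fun u => norm_nonneg _)]
    exact hbound β

/-- `U_a` is integrable on bounded intervals. [folklore] -/
theorem intervalIntegrable_arcsinePot {a : ℝ} (ha : 0 < a) (s₀ s₁ : ℝ) :
    IntervalIntegrable (arcsinePot a) volume s₀ s₁ := by
  wlog hs : s₀ ≤ s₁ generalizing s₀ s₁
  · exact (this s₁ s₀ (le_of_not_ge hs)).symm
  rw [intervalIntegrable_iff_integrableOn_Ioc_of_le hs]
  have h := (integrable_log_abs_sub_mul_cos_prod ha hs).integral_prod_right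
  refine (h.const_mul π⁻¹).congr (Eventually.of_forall fun u => ?_)
  simp only [arcsinePot]
  rw [integral_of_le Real.pi_pos.le]

/-- **`∫_{s₀}^{s₁} U_a = -(Ψ_a(s₁) - Ψ_a(s₀))`**: the linear potential is a primitive of minus
the logarithmic potential of the arcsine law (Fubini and `∫ log |u - c| du = Λ(u - c)`).
[folklore] -/
theorem integral_arcsinePot {a : ℝ} (ha : 0 < a) (s₀ s₁ : ℝ) :
    ∫ u in s₀..s₁, arcsinePot a u = -(arcsineLinPot a s₁ - arcsineLinPot a s₀) := by
  wlog hs : s₀ ≤ s₁ generalizing s₀ s₁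
  · rw [integral_symm, this s₁ s₀ (le_of_not_ge hs)]; ring
  have hπ := Real.pi_pos
  have hint := integrable_log_abs_sub_mul_cos_prod ha hs
  -- swap the two integrals
  have hswap : ∫ u in s₀..s₁, ∫ β in (0:ℝ)..π, Real.log |u - a * Real.cos β| =
      ∫ β in (0:ℝ)..π, ∫ u in s₀..s₁, Real.log |u - a * Real.cos β| := by
    have h := integral_integral_swap (f := fun (β u : ℝ) => Real.log |u - a * Real.cos β|) hint
    simp only [integral_of_le hs, integral_of_le hπ.le]
    exact h.symm
  simp only [arcsinePot, arcsineLinPot]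
  rw [intervalIntegral.integral_const_mul, hswap]
  have hinner : ∀ β, ∫ u in s₀..s₁, Real.log |u - a * Real.cos β| =
      -logPrim (a * Real.cos β - s₁) - -logPrim (a * Real.cos β - s₀) := by
    intro β
    rw [integral_log_abs_sub_eq_logPrim, ← logPrim_neg, ← logPrim_neg, neg_sub, neg_sub]
  simp_rw [hinner]
  have hc : ∀ s, Continuous fun β => logPrim (a * Real.cos β - s) := fun s =>
    continuous_logPrim.comp ((continuous_const.mul Real.continuous_cos).sub continuous_const)
  have hi1 : IntervalIntegrable (fun β => -logPrim (a * Real.cos β - s₁)) volume 0 π :=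
    (hc s₁).neg.intervalIntegrable _ _
  have hi0 : IntervalIntegrable (fun β => -logPrim (a * Real.cos β - s₀)) volume 0 π :=
    (hc s₀).neg.intervalIntegrable _ _
  rw [intervalIntegral.integral_sub hi1 hi0, intervalIntegral.integral_neg, intervalIntegral.integral_neg]
  ring

/-- `Ψ_a` is continuous. [folklore] -/
theorem continuous_arcsineLinPot (a : ℝ) : Continuous (arcsineLinPot a) := by
  unfold arcsineLinPot
  refine continuous_const.mul (continuous_parametric_intervalIntegral_of_continuous' ?_ 0 π)
  exact continuous_logPrim.comp (((Real.continuous_cos.comp continuous_snd).const_mul a).sub continuous_fst)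

/-! ### Non-negativity of the linear term -/

/-- **The linear term is non-negative.** Let `η` be a bounded measurable density vanishing off
`[-L, L]` with `∫ η = 0` (charge neutrality) and `∫ x η(x) dx = 0` (equal areas), non-negative on
`(-∞, -a)` and non-positive on `(a, ∞)`. Then `0 ≤ ∫ η Ψ_a`. Indeed
`Ψ_a(x) = Ψ_a(0) - x log (a/2) - W(x)` with `W(x) = ∫_0^x (U_a - log (a/2))`, which vanishes on
`[-a, a]` (the potential is constant on the segment), is `≥ 0` to the right and `≤ 0` to the left,
so `∫ η Ψ_a = -∫ η W ≥ 0`. This is Vershik–Kerov's `θ̄_N(f) ≥ 0` (the limit shape is a critical point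
of the hook integral and diagrams lie above `|x|`). [cite: VershikKerov1985, Lemma 4] -/
theorem integral_mul_arcsineLinPot_nonneg {η : ℝ → ℝ} {C L a : ℝ} (hηm : Measurable η)
    (hηC : ∀ x, |η x| ≤ C) (hη0 : ∀ x ∉ Icc (-L) L, η x = 0) (ha : 0 < a)
    (hint0 : ∫ x, η x = 0) (hint1 : ∫ x, x * η x = 0)
    (hpos : ∀ x, x < -a → 0 ≤ η x) (hneg : ∀ x, a < x → η x ≤ 0) :
    0 ≤ ∫ x, η x * arcsineLinPot a x := by
  set c₀ : ℝ := Real.log (a / 2) with hc₀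
  set W : ℝ → ℝ := fun x => arcsineLinPot a 0 - arcsineLinPot a x - c₀ * x with hW
  have hWc : Continuous W := (continuous_const.sub (continuous_arcsineLinPot a)).sub
    (continuous_const.mul continuous_id)
  -- `W(x) = ∫_0^x (U_a - c₀)`
  have hWint : ∀ x, W x = ∫ u in (0:ℝ)..x, (arcsinePot a u - c₀) := by
    intro x
    rw [intervalIntegral.integral_sub (intervalIntegrable_arcsinePot ha _ _) intervalIntegrable_const,
      integral_arcsinePot ha, intervalIntegral.integral_const, smul_eq_mul, sub_zero, hW]
    ring
  -- sign of `W`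
  have hW0 : ∀ x, |x| ≤ a → W x = 0 := by
    intro x hx
    rw [hWint]
    rw [intervalIntegral.integral_congr (g := fun _ => (0:ℝ)) fun u hu => ?_, intervalIntegral.integral_zero]
    have hu' : |u| ≤ a := by
      rcases le_total 0 x with h0x | hx0
      · rw [uIcc_of_le h0x] at hu
        rw [abs_le]; constructor <;> linarith [hu.1, hu.2, (abs_le.mp hx).2]
      · rw [uIcc_of_ge hx0] at hu
        rw [abs_le]; constructor <;> linarith [hu.1, hu.2, (abs_le.mp hx).1]
    simp only
    rw [arcsinePot_eq_log ha hu', hc₀, sub_self]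
  have hWpos : ∀ x, a < x → 0 ≤ W x := by
    intro x hx
    rw [hWint]
    exact intervalIntegral.integral_nonneg (by linarith) fun u _ => sub_nonneg.mpr (log_le_arcsinePot ha u)
  have hWneg : ∀ x, x < -a → W x ≤ 0 := by
    intro x hx
    rw [hWint, integral_symm]
    have h : 0 ≤ ∫ u in x..0, (arcsinePot a u - c₀) :=
      intervalIntegral.integral_nonneg (by linarith) fun u _ => sub_nonneg.mpr (log_le_arcsinePot ha u)
    linarith
  -- pointwise `-(η W) ≥ 0`
  have hpt : ∀ x, 0 ≤ -(η x * W x) := by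
    intro x
    rcases lt_or_ge x (-a) with h1 | h1
    · have := hpos x h1; have := hWneg x h1; nlinarith
    rcases lt_or_ge a x with h2 | h2
    · have := hneg x h2; have := hWpos x h2; nlinarith
    · rw [hW0 x (abs_le.mpr ⟨h1, h2⟩)]; simp
  -- integrate
  have hdecomp : ∀ x, η x * arcsineLinPot a x =
      arcsineLinPot a 0 * η x - c₀ * (x * η x) + -(η x * W x) := by
    intro x; simp only [hW]; ring
  simp_rw [hdecomp]
  have hi1 : Integrable fun x => arcsineLinPot a 0 * η x := (integrable_of_bounded_Icc hηm hηC hη0).const_mul _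
  have hi2 : Integrable fun x => c₀ * (x * η x) := by
    have h := integrable_mul_continuous hηm hηC hη0 continuous_id
    exact (h.const_mul c₀).congr (Eventually.of_forall fun x => by simp [mul_comm])
  have hi3 : Integrable fun x => -(η x * W x) := (integrable_mul_continuous hηm hηC hη0 hWc).neg
  have hi12 : Integrable fun x => arcsineLinPot a 0 * η x - c₀ * (x * η x) := hi1.sub hi2
  rw [MeasureTheory.integral_add hi12 hi3, MeasureTheory.integral_sub hi1 hi2,
    MeasureTheory.integral_const_mul, MeasureTheory.integral_const_mul, hint0, hint1]
  simp only [mul_zero, sub_zero, zero_add]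
  exact integral_nonneg hpt

end Literature.Analysis.Potential

end
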